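import Literature.MathematicalPhysics.QuantumFieldTheory.Balaban1983to89.Node00.Record13CoPH
import Literature.MathematicalPhysics.QuantumFieldTheory.Balaban1983to89.Node00.Record13SepCoPR

/-!
# NODE 00 (YM-PLAN Track A) — RECORD 13, §11 (v1.7 `SepCoPH`): ROW P11 ON PRINT'S SEQUENCES, PARTITION-COMPATIBLE RUNS AND PRINT'S (7)-REGULAR DATA AT
# THE Co-CLASS BACKGROUND, OVER THE HISTORY-INDEXED RESIDUAL 𝐓-WEIGHT SLOT `Zh` AND SMEARING SLOT `Phih` (FINDING №9; director-ym LINES №183 H1ʰ ∕ №186–№187)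
# — keyed on FILE 27 `Node00/Record13CoPH.lean`, AS A SIBLING MODULE

This module IS §11 of RECORD 13 at the v1.7 `CoPH` edition (node00-def-T FILE 28T, 2026-08-27): the VERBATIM image of the landed v1.6 = FILE 26T
`Node00/Record13SepCoPR.lean` (row `bg` on print's sequences `Seq₀`, partition-compatible runs, (7)-regular data at the Co-CLASS background `UbgOfRecord₁₃CoP` over
print's top domain `Ω₀`, print's `ζ`) under T₇ = KEY-RULE-27 (FILE 27's header): binder `θ : Stage13HParams F N`, namespace `Stage13RParams. ↦ Stage13HParams.`, seed
`WtOfRecord₁₃R θ p ↦ WtOfRecord₁₃H θ p s` (the history's residual `θ.zhAt p s = θ.Zh p n s.Ω s.Λ`, DESIGN (α)), core `Provisos₁₃CoPR ↦ Provisos₁₃CoPH`, proviso rows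
`zrLaws ∕ zrLocal ↦ zhLaws : ∀ p n Ω Λ, (θ.Zh p n Ω Λ).Laws ∕ zhLocal : ∀ p n Ω Λ, (θ.Zh p n Ω Λ).LocalLaws`, edition token `SepCoPR ↦ SepCoPH` (and `CoPR ↦ CoPH` for
the FILE 27 names it cites), SITE RULE S₇ at the two §2-predicate heads (`sect2Form_stage13SepCoPH_iff`'s right side and
`hasSect2FormAEZS_succ_of_isRecordOfRecord₁₃CSepCoPH`'s conclusion: `HasSect2FormAEZS … n (θ.rzAt P) (WtOfRecord₁₃H θ P)`), and every function NOT re-issued at its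
v1.6 site `θ.toStage13Params` — in particular row `bg` is typed VERBATIM at `settingOfRecord₁₃ F N θ.toStage13Params p`, THE TORUS RESIDUAL `θ.Rz p.K`,
`suppOfRecord₁₃SepCoP F N θ.toStage13Params p n` and `UbgOfRecord₁₃CoP F N θ.toStage13Params p n` (the background, the support and the (7)₀ guard read NEITHER
residual slot and are CITED from FILE 23 ∕ 24T, not re-issued; the history's §2 residual `θ.rzAt p s` builds the SAME spaces `U^c_j`, `Ũ^c_j` as `θ.Rz p.K` —
`Stage13HParams.bgProvisoΛ_rzAt_iff`, `Iff.rfl`, FILE 27 §0b — so row `bg` serves every history: `norm_E_bg_le_stage13SepCoPH`, same statement, proof through that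
door).  Two units are hand-adapted with v1.6's statements made per-history: `Stage13HParams.Provisos₁₃SepCoPH.wtLaws (p) (s) : (WtOfRecord₁₃H θ p s).Laws` and
`norm_E_bg_le_stage13SepCoPH` (proof only).

NAME CONTINUITY (pub-ymgap-plan IMPACT-183): `Stage13HParams.Provisos₁₃SepCoPH` has the SAME fields in the SAME order with the SAME pins as v1.6's
`Stage13RParams.Provisos₁₃SepCoPR` except `zrLaws ∕ zrLocal ↦ zhLaws ∕ zhLocal` (faces `.toCore : … → θ.Provisos₁₃CoPH F N`, `.odd_M`, `.not_four_dvd_M`,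
`.M₁_dvd_dCubeSide`, `.wtLaws`, `.tstep` verbatim); the datum ∕ record family `towerOfRecord₁₃SepCoPH` (`= towerOfRecord₁₃CoPH F N θ h.toCore`, the named `rfl` face
`towerOfRecord₁₃SepCoPH_eq_coPH`), `datumOfRecord₁₃SepCoPH` (`= datumOfRecord₁₃CoPH F N θ h.toCore`, the named `rfl` face `datumOfRecord₁₃SepCoPH_eq_coPH` — 26T NIT-1:
the face IS a named lemma, here and at v1.6 (`datumOfRecord₁₃SepCoPR_eq_coPR`)), `isDatumOfRecord₀_datumOfRecord₁₃SepCoPH`, `datumOfRecord₁₃SepCoPH_C`,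
`flow_g_datumOfRecord₁₃SepCoPH`, `IsRecordOfRecord₁₃CSepCoPH` (`∃ (θ : Stage13HParams F N) (h : θ.Provisos₁₃SepCoPH F N), θ.Admissible F N ∧ D = datumOfRecord₁₃SepCoPH F N θ h
∧ …`), `IsRecordOfRecord₁₃CSepCoPH.toCoPH`, `exists_world_isRecordOfRecord₁₃CSepCoPH`, `endStatementBPrinted_of_isRecordOfRecord₁₃CSepCoPH_of_nodes`, … are the images
of the 26T names one for one (token table T₇ ∕ KEYMAP v1.7 on the cell bus).  The datum and ALL its faces read NEITHER `Zh` NOR `Phih` (tribunal (Q-J)(b); kernel: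
`datumOfRecord₁₃SepCoPH_ofHistoryBlind`, `rfl`).  §H2 — the history-blind embedding at the separated range: `Stage13RParams.Provisos₁₃SepCoPR.ofHistoryBlind :
θ.Provisos₁₃SepCoPR F N → (Stage13HParams.ofHistoryBlind F N θ).Provisos₁₃SepCoPH F N` (+ `_toCore`, `rfl`), `datumOfRecord₁₃SepCoPH_ofHistoryBlind` (`rfl`),
`IsRecordOfRecord₁₃CSepCoPH.ofCoPR` (every v1.6 record IS a v1.7 record; one-way) and, composed with FILE 26T §R2, `IsRecordOfRecord₁₃CSepCoPH.ofCoP` (every v1.5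
record IS a v1.7 record) — whence the K-text bridge «⁷-inhabited ⇐ ⁶-inhabited» is the consumer's one-liner.  HYP-AUDIT: no hypothesis of any imaged statement is
dropped, weakened or added; binder lists verbatim up to S₇ and the two per-history units named above; proofs re-checked, no `sorry`; no instance, no notation, no
attribute; nothing landed is edited.

HONEST FRAMING.  Definitions and verbatim-imaged bookkeeping of record — a faithfulness-of-INDEX repair of a DATUM of a CONDITIONAL record; NOTHING of Bałaban is
asserted ([15] Thm 1, (2.27)(iv), hypothesis (B), [V] Thm 1 remain hypotheses ∕ sockets); the node item K0 `Record13SepCoPRInhabited` is NOT discharged by this file —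
pub-ymgap-plan rev 24 re-keys K0–K3 ONCE on the names below under T₇ (director-ym №183 ∕ №187); a re-key is not progress; counts UNMOVED (typed 28∕28 · discharged
5∕28); one finite 𝕋⁴ programme at fixed ε = L^{−K} — NOT the continuum ∕ ℝ⁴ ∕ OS ∕ mass-gap ∕ Clay statement.  References: [III] = Balaban1988Convergent, [6] =
Balaban1985RegularSpaces, [15] = Balaban1985Variational, [IV] = Balaban1989LargeFieldI, [V] = Balaban1989LargeFieldII, [B8] = Balaban1987RG1.
-/

noncomputable section

open MeasureTheory
open scoped Matrix.Norms.L2Operator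

namespace Literature.MathematicalPhysics.QuantumFieldTheory.Balaban1983to89.Node00

open T4Continuum AveragingRT T4FiniteEpsInhabited FlowStep FlowStepRuns DagBinding T4DatumAssembly
open B12Eq019ActionBody (integrand)

variable (F : T4Family) (N : ℕ) [NeZero N]

/-! ## §11 (H). ROW P11 AT THE Co-CLASS BACKGROUND OF RECORD OVER THE HISTORY-INDEXED RESIDUAL 𝐓-WEIGHT SLOT: the displayed provisos `Provisos₁₃SepCoPH` (= `Provisos₁₃SepCoPR`'s rows
with `zrLaws ∕ zrLocal ↦ zhLaws ∕ zhLocal`; row `bg` UNCHANGED, over FILE 24T's support `suppOfRecord₁₃SepCoP` AT FILE 23's background `UbgOfRecord₁₃CoP`, both CITED at `θ.toStage13Params`,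
at the torus residual `θ.Rz p.K` — the history's residual `θ.rzAt p s` builds the SAME spaces: `Stage13HParams.bgProvisoΛ_rzAt_iff`), its θ-level pins, the readers, the tower ∕ datum = FILE 27's
core ones at `h.toCore` by `rfl`, and the twin face family — every v1.6 statement of FILE 26T from `Provisos₁₃SepCoPR` on VERBATIM under T₇ -/

section CoRangeH

/-- **THE DISPLAYED PROVISOS at `θ : Stage13HParams`, Stage 13, ROW P11 ON PRINT'S SEQUENCES AND PRINT'S (7)-REGULAR DATA, AT THE Co-CLASS BACKGROUND OF RECORD,
OVER THE HISTORY-INDEXED RESIDUAL 𝐓-WEIGHT SLOT** (v1.7 `H` — the successor of v1.4∕v1.5's `Provisos₁₃SepCoP` under director-ym LINE №183 H1ʰ, FINDING №9 (over LINE №169 H1, FINDING №8)): the rows of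
`Provisos₁₃SepCoP` VERBATIM — same field names, same order, the θ-level letters `hM` ([III] p. 245 «M = L^m») and `hM₁` (H1 «M₁ ∣ M») included, row `bg` UNCHANGED
(def-R's ranged background proviso `BgProvisoΛ` over the separated (7)-regular support `suppOfRecord₁₃SepCoP` AT the Co-class background `UbgOfRecord₁₃CoP`, both
CITED from FILE 24T ∕ 23 at `θ.toStage13Params` — neither reads the residual 𝐓-weight slot) — except that v1.6's two rows on the RUN-INDEXED slot `zrLaws ∕ zrLocal` are
REPLACED by `zhLaws : ∀ (p : B12.RunParams) (n : ℕ) (Ω Λ : ℕ → Set (Site (F.P p.K) 0)), (θ.Zh p n Ω Λ).Laws` ∕ `zhLocal : ∀ (p : B12.RunParams) (n : ℕ) (Ω Λ : ℕ → Set (Site (F.P p.K) 0)), (θ.Zh p n Ω Λ).LocalLaws` on the HISTORY-INDEXED slot `θ.Zh`.  `.toCore` projects to the bg-free core `Provisos₁₃CoPH`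
(FILE 27); there is NO row map from or to `Provisos₁₃SepCoPR` ∕ `…SepCoP` (their `zr` ∕ `zt` rows speak of other slots) except the history-blind door `Provisos₁₃SepCoPR.ofHistoryBlind` (§H2).  Rows `intPiece` ∕ `measω` ∕ `measChi` ∕ `rstep` remain THEOREMS of
(H-U) and the ζ-laws (RECORD 13 §4c); the comparability of thresholds and the monotonicity of the history are NOT displayed here.  HYPOTHESES, never admissibility
clauses, never asserted. [cite: Balaban1988Convergent, (1.11) p.248, (2.1) p.254, (2.7) p.255, p.256, (2.18) p.257, (2.21) p.258, (2.28) p.259, (3.2)–(3.9) pp.265–266, (3.16) p.268, (3.20)–(3.21) p.269; Balaban1985RegularSpaces, (1.3)–(1.9) pp.76–77, (7) p.278; Balaban1985Variational, Thm 1 + (5)–(6) p.20] -/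
structure Stage13HParams.Provisos₁₃SepCoPH (θ : Stage13HParams F N) : Prop where
  /-- the level-`k` pieces `χ_k(s)·slot_k(s)` of `ρ_k` are integrable, `k < K`, along the ₁₃ histories -/
  intPiece : ∀ (p : B12.RunParams) (k : ℕ), k < p.K → ∀ s : SeqOfRecord F θ.ν θ.τ9.M (gOfRecord₁₃ F N θ.toStage13Params p) p.K k,
    Integrable (fun U => chiSeqOfRecord F N θ.ν θ.τ9.M (gOfRecord₁₃ F N θ.toStage13Params p) p.K k s U *
      slotsOfRecord F N θ.ν θ.τ9 (EOfRecord₁₃ F N θ.toStage13Params) (wOfRecord₉ F N θ.toStage9Params) θ.ppSel p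
        (gOfRecord₁₃ F N θ.toStage13Params p) k s U) (fieldMeasure (F.P p.K) k (SU N))
  /-- (O4): the label weights `ω = a·b·ζ` are jointly measurable in `(V′, U)`, `k < K`, along the ₁₃ histories -/
  measω : ∀ (p : B12.RunParams) (k : ℕ), k < p.K → ∀ (s : SeqOfRecord F θ.ν θ.τ9.M (gOfRecord₁₃ F N θ.toStage13Params p) p.K k)
    (t : LbOfRecord F θ.ν p (gOfRecord₁₃ F N θ.toStage13Params p) k),
    Measurable (fun z : GaugeField (F.P p.K) (k + 1) (SU N) × GaugeField (F.P p.K) k (SU N) =>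
      ωOfRecord F N θ.ν θ.τ9.M p (gOfRecord₁₃ F N θ.toStage13Params p) k θ.A₁ θ.ζ s t z.2 z.1)
  /-- the new front factors `χ_{k+1}(s′)` are measurable, `k < K`, along the ₁₃ histories -/
  measChi : ∀ (p : B12.RunParams) (k : ℕ), k < p.K → ∀ s' : SeqOfRecord F θ.ν θ.τ9.M (gOfRecord₁₃ F N θ.toStage13Params p) p.K (k + 1),
    Measurable (chiSeqOfRecord F N θ.ν θ.τ9.M (gOfRecord₁₃ F N θ.toStage13Params p) p.K (k + 1) s')
  /-- the residual `ζ` resolves unity -/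
  zetaUnity : IsZetaUnity F N θ.ν θ.τ9.M θ.ζ
  /-- the residual `ζ` has `Σ |ζ| ≤ 1` -/
  zetaAbs : IsZetaAbsLeOne F N θ.ν θ.τ9.M θ.ζ
  /-- def-R's (0.3) provisos of the pre-𝐑 tower of record, INTEGRABLE FORM (`RepData.ProvisosInt`), at every level `k+1 ≤ K`, along the ₁₃ histories, at
  every instance -/
  rstep : ∀ (p : B12.RunParams) (k : ℕ) [DecidableEq (PBond (F.P p.K) (k + 1))], k < p.K →
    (towerRepOfRecord F N θ.ν θ.τ9 (slotsTOfRecord F N θ.ν θ.τ9 (EOfRecord₁₃ F N θ.toStage13Params) (wOfRecord₉ F N θ.toStage9Params) θ.ppSel)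
      θ.ppSel p (gOfRecord₁₃ F N θ.toStage13Params p) (k + 1)).toRepData.ProvisosInt
  /-- 11c's laws of the residual §2 data -/
  rzLaws : ∀ K, (θ.Rz K).Laws
  /-- (v1.7 · HISTORY-INDEXED, FINDING №9) 12a's law of the residual part of the 𝐓-weights OF THE RUN AT EVERY STEP ALONG EVERY HISTORY: `ζ0 ≥ 0` -/
  zhLaws : ∀ (p : B12.RunParams) (n : ℕ) (Ω Λ : ℕ → Set (Site (F.P p.K) 0)), (θ.Zh p n Ω Λ).Laws
  /-- (v1.7 · HISTORY-INDEXED) the locality law of the residual 𝐓-weight factor OF THE RUN AT EVERY STEP ALONG EVERY HISTORY -/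
  zhLocal : ∀ (p : B12.RunParams) (n : ℕ) (Ω Λ : ℕ → Set (Site (F.P p.K) 0)), (θ.Zh p n Ω Λ).LocalLaws
  /-- [III] p. 245 «M = L^m is sufficiently large»: the 𝐑-operation cube side `M` is a POWER OF `L` (θ-level letter of print; tribunal J
  TRIB-J-Q1 2026-08-27: with `Odd L` it excludes `4 ∣ M`, under which `PartCompat₁₃ θ p n` fails for every `n ≥ 1` and row `bg` idles) -/
  hM : ∃ a : ℕ, θ.τ9.M = F.L ^ a
  /-- [III] p. 245 «M₁ = L^{m₁}, M₂ = L^{m₂}, M₁ < M₂ < M» read as the DIVISIBILITY letter H1 of HYP-AUDIT-13 (director-ym №145 (F2)): the layer width `M₁`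
  of the (2.13) determining sets divides the 𝐑-cube side `M`, hence every 𝐃_j-cube side `L^j·M·R_j` — so `Ω_j`, `Λ_j ∈ 𝐃_j` are unions of the
  `M₁L^jη`-blocks of [15] (1) ∕ [6] (1.4) (θ-level, run-free; `M₁_dvd_dCubeSide`) -/
  hM₁ : θ.ν.M₁ ∣ θ.τ9.M
  /-- p. 259, ON PRINT'S RANGES AND PRINT'S SEQUENCES (v1.4): the Co-CLASS background of record
  `UbgOfRecord₁₃CoP` (def-R `UbgMSCoPOfRecord` at the positive levels; director-ym №149 (3)) lies in `U^c_j(X, α_{0,j}, α_{1,j})` for the domains `X ⊂ Λ_j(s)` of the (2.26)–(2.27) ∕ (2.30) sums and in `Ũ^c_j(X)` for the domains of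
  the (2.41)(i) range, on the regular retained configurations AT SEPARATED (2.18) indices `s` ([6] (1.3)–(1.6)) — every run whose ₁₃ history stays in
  the window `]0, γ]` up to the length `n ≤ K` AND whose 𝐃_j-partitions, `1 ≤ j ≤ n`, are compatible with the torus ([III] p. 257; `PartCompat₁₃`, plan WORD-T2) -/
  bg : ∀ (p : B12.RunParams) (n : ℕ), n ≤ p.K → Step.InInterval θ.γ n (gOfRecord₁₃ F N θ.toStage13Params p) → PartCompat₁₃ F N θ.toStage13Params p n →
    BgProvisoΛ F N p.K (settingOfRecord₁₃ F N θ.toStage13Params p) (θ.Rz p.K) θ.τ9.M n (suppOfRecord₁₃SepCoP F N θ.toStage13Params p n) (UbgOfRecord₁₃CoP F N θ.toStage13Params p n)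
  /-- **(H-ζ) ROW** (v1.8 · director-ym №228 LOCATED-ζ · plan g87 S2-FULL): the residual fluctuation factor `ζ` of the record is jointly
  measurable in the old and new fields — the displayed bookkeeping proviso `ZetaMeasurable` (RECORD 12 measurability), until v1.7 threaded
  as a separate hypothesis `hζ`, now a ROW of every Stage-13 proviso edition.  A REAL, REQUIRED field (readers: `h.zetaMeas`); the `autoParam`
  default below only FILLS it at a construction site that omits it — from a Stage-13 proviso value of ANY edition already in hand (the
  transports ∕ doors) or from an `hζ` in context (the from-scratch selectors) — and fails loudly with the goal displayed otherwise.
  HYPOTHESIS, never an admissibility clause, never asserted. [cite: Balaban1988Convergent, (3.16) p.268, (3.20)–(3.21) p.269 (bookkeeping)] -/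
  zetaMeas : ZetaMeasurable F N θ.ζ := by
    first
      | (have h' := ‹_root_.Literature.MathematicalPhysics.QuantumFieldTheory.Balaban1983to89.Node00.Stage13Params.Provisos₁₃ _ _ _›; exact h'.zetaMeas)
      | (have h' := ‹_root_.Literature.MathematicalPhysics.QuantumFieldTheory.Balaban1983to89.Node00.Stage13Params.Provisos₁₃Core _ _ _›; exact h'.zetaMeas)
      | (have h' := ‹_root_.Literature.MathematicalPhysics.QuantumFieldTheory.Balaban1983to89.Node00.Stage13Params.Provisos₁₃Sep _ _ _›; exact h'.zetaMeas)
      | (have h' := ‹_root_.Literature.MathematicalPhysics.QuantumFieldTheory.Balaban1983to89.Node00.Stage13Params.Provisos₁₃SepCo _ _ _›; exact h'.zetaMeas)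
      | (have h' := ‹_root_.Literature.MathematicalPhysics.QuantumFieldTheory.Balaban1983to89.Node00.Stage13Params.Provisos₁₃SepMixed _ _ _›; exact h'.zetaMeas)
      | (have h' := ‹_root_.Literature.MathematicalPhysics.QuantumFieldTheory.Balaban1983to89.Node00.Stage13Params.Provisos₁₃SepCoP _ _ _›; exact h'.zetaMeas)
      | (have h' := ‹_root_.Literature.MathematicalPhysics.QuantumFieldTheory.Balaban1983to89.Node00.Stage13RParams.Provisos₁₃CoPR _ _ _›; exact h'.zetaMeas)
      | (have h' := ‹_root_.Literature.MathematicalPhysics.QuantumFieldTheory.Balaban1983to89.Node00.Stage13RParams.Provisos₁₃SepCoPR _ _ _›; exact h'.zetaMeas)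
      | (have h' := ‹_root_.Literature.MathematicalPhysics.QuantumFieldTheory.Balaban1983to89.Node00.Stage13HParams.Provisos₁₃CoPH _ _ _›; exact h'.zetaMeas)
      | (have h' := ‹_root_.Literature.MathematicalPhysics.QuantumFieldTheory.Balaban1983to89.Node00.Stage13HParams.Provisos₁₃SepCoPH _ _ _›; exact h'.zetaMeas)
      | assumption

variable {F N}

/-- The separated-range provisos PROJECT to the core (drop `bg`). [cite: Balaban1988Convergent, (2.18) p.257 (bookkeeping)] -/
theorem Stage13HParams.Provisos₁₃SepCoPH.toCore {θ : Stage13HParams F N} (h : θ.Provisos₁₃SepCoPH F N) : θ.Provisos₁₃CoPH F N where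
  intPiece := h.intPiece
  measω := h.measω
  measChi := h.measChi
  zetaUnity := h.zetaUnity
  zetaAbs := h.zetaAbs
  rstep := fun p k _ hk => h.rstep p k hk
  rzLaws := h.rzLaws
  zhLaws := h.zhLaws
  zhLocal := h.zhLocal

/-- (v1.4 pin, as v1.3; tribunal J TRIB-J-Q1 ∕ director-ym №145 (F3)) **`M` IS ODD**: `M = L^a` with `L` odd (`T4Family.hL`).  [cite: Balaban1988Convergent, p.245 (bookkeeping)] -/
theorem Stage13HParams.Provisos₁₃SepCoPH.odd_M {θ : Stage13HParams F N} (h : θ.Provisos₁₃SepCoPH F N) : Odd θ.τ9.M := by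
  obtain ⟨a, ha⟩ := h.hM
  rw [ha]
  exact F.hL.1.pow

/-- (v1.4 pin, as v1.3; director-ym №145 (F3)) **THE ANTI-DODGE CERTIFICATE `¬ 4 ∣ M`**: the junk numerics `M := 4` under which `PartCompat₁₃ θ p n` fails for every
`n ≥ 1` (so that row `bg` idles; vet ym-vet-20289, Summits-side `…/Negative/PartCompatDodge.lean`) carry NO v1.3 proviso set — the hypothesis `4 ∣ M` of
that dodge contradicts the field `hM`. [cite: Balaban1988Convergent, p.245, p.257 (bookkeeping)] -/
theorem Stage13HParams.Provisos₁₃SepCoPH.not_four_dvd_M {θ : Stage13HParams F N} (h : θ.Provisos₁₃SepCoPH F N) : ¬ 4 ∣ θ.τ9.M := fun h4 =>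
  (Nat.not_even_iff_odd.mpr h.odd_M) (even_iff_two_dvd.mpr (dvd_trans (by norm_num : (2 : ℕ) ∣ 4) h4))

/-- (v1.4 pin, as v1.3; director-ym №145 (F2)) **H1 AT EVERY 𝐃_j-CUBE**: `M₁ ∣ L^j·M·R_j` = `dCubeSide L M R_j j` for every `L`, `R_j`, `j` — the (2.13) layers tile
the 𝐃_j-cubes ([15] (1) ∕ [6] (1.4) «Ω_j a union of M₁L^jη-blocks»). [cite: Balaban1985RegularSpaces, (1) p.277; Balaban1988Convergent, (2.1) p.254, (2.13) p.256 (bookkeeping)] -/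
theorem Stage13HParams.Provisos₁₃SepCoPH.M₁_dvd_dCubeSide {θ : Stage13HParams F N} (h : θ.Provisos₁₃SepCoPH F N) (L R j : ℕ) :
    θ.ν.M₁ ∣ dCubeSide L θ.τ9.M R j :=
  (Dvd.dvd.mul_left h.hM₁ (L ^ j)).mul_right R

/-- (v1.7 `H` · v1.4 SEPARATED (7)-REGULAR RANGE · Co-CLASS BACKGROUND) The weight laws of the run FOR EVERY HISTORY, FROM the provisos (row `zhLaws`). [cite: Balaban1988Convergent, (2.21) p.258 (bookkeeping)] -/
theorem Stage13HParams.Provisos₁₃SepCoPH.wtLaws {θ : Stage13HParams F N} (h : θ.Provisos₁₃SepCoPH F N) (p : B12.RunParams) {n : ℕ}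
    (s : SeqOfRecord F θ.ν θ.τ9.M (gOfRecord₁₃ F N θ.toStage13Params p) p.K n) : (WtOfRecord₁₃H F N θ p s).Laws :=
  WtOfRecord₁₃H_laws h.zhLaws p s

/-- (v1.7 `H` · v1.4 SEPARATED (7)-REGULAR RANGE · Co-CLASS BACKGROUND) **def-T's step provisos FROM the Stage-13 provisos** at every step `k < K` (as FILE 10's `Provisos₁₀.tstep`, along the ₁₃ histories).
[cite: Balaban1988Convergent, (3.2)–(3.9) pp.265–266, (3.16) p.268, (3.24)–(3.25) p.270] -/
theorem Stage13HParams.Provisos₁₃SepCoPH.tstep {θ : Stage13HParams F N} (h : θ.Provisos₁₃SepCoPH F N) (p : B12.RunParams) (k : ℕ) (hk : k < p.K) :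
    TStepProvisos F N θ.ν θ.τ9 (EOfRecord₁₃ F N θ.toStage13Params) (wOfRecord₉ F N θ.toStage9Params) θ.ppSel p
      (gOfRecord₁₃ F N θ.toStage13Params p) k where
  intPiece := h.intPiece p k hk
  measW := fun s' => measurable_wOfRecord F N θ.ν θ.τ9.M θ.A₁ θ.ζ p (gOfRecord₁₃ F N θ.toStage13Params p) k (h.measω p k hk) s'
  absW_le := fun s' U V' => abs_wOfRecord_le_one F N θ.ν θ.τ9.M θ.A₁ h.zetaAbs p (gOfRecord₁₃ F N θ.toStage13Params p) k s' U V'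
  measChi := h.measChi p k hk
  unity := isStepUnity_wOfRecord F N θ.ν θ.τ9.M θ.A₁ h.zetaUnity p (gOfRecord₁₃ F N θ.toStage13Params p) k

/-- (v1.7 `H` · v1.4 SEPARATED (7)-REGULAR RANGE · Co-CLASS BACKGROUND) **NON-VACUITY OF THE SPACES OF RECORD AT THE RECORD, IN THE WINDOW**, Stage 13 (11c's `Sect2.one_mem_spaceI`; radii by `alphaPos₁₂_of_window`).
[cite: Balaban1987RG1, (1.11)–(1.16) p.262; Balaban1988Convergent, (2.28) p.259] -/
theorem one_mem_spaceI_stage13SepCoPH {θ : Stage13HParams F N} (h : θ.Provisos₁₃SepCoPH F N) (hθ : θ.Admissible F N) (p : B12.RunParams) (j : ℕ) (Y : Set (Site (F.P p.K) 0))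
    (hw : 0 < gOfRecord₁₃ F N θ.toStage13Params p j ∧ gOfRecord₁₃ F N θ.toStage13Params p j ≤ θ.γ) :
    Sect2.ofBackgroundC (ιSU N) (1 : GaugeField (F.P p.K) 0 (SU N)) ∈
      Sect2.spaceI (settingOfRecord₁₃ F N θ.toStage13Params p) (θ.Rz p.K) θ.τ9.M j Y ((lfOfRecord₁₂ F N θ.toStage12Params).alpha0 (gOfRecord₁₃ F N θ.toStage13Params p j))
        ((lfOfRecord₁₂ F N θ.toStage12Params).alpha1 (gOfRecord₁₃ F N θ.toStage13Params p j)) :=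
  Sect2.one_mem_spaceI (settingOfRecord₁₃ F N θ.toStage13Params p) hθ.1.pos.1 (h.rzLaws p.K) θ.τ9.M j Y (alphaPos₁₂_of_window hθ.1 hw.1 hw.2).1
    (alphaPos₁₂_of_window hθ.1 hw.1 hw.2).2

/-- (v1.7 `H` · v1.4 SEPARATED (7)-REGULAR RANGE · Co-CLASS BACKGROUND) … and in `Ũ^c_j(X, α̃₀, α̃₁)` of record along the sequence's large-field regions, GIVEN positive radii at every level. [cite: Balaban1988Convergent, (2.34)–(2.39) p.261] -/
theorem one_mem_spaceMS_stage13SepCoPH {θ : Stage13HParams F N} (h : θ.Provisos₁₃SepCoPH F N) (hθ : θ.Admissible F N) (p : B12.RunParams) (j : ℕ) (Y : Set (Site (F.P p.K) 0))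
    (Ω : ℕ → Set (Site (F.P p.K) 0))
    (hα : ∀ n, 0 < (lfOfRecord₁₂ F N θ.toStage12Params).alpha0 (gOfRecord₁₃ F N θ.toStage13Params p n) ∧ 0 < (lfOfRecord₁₂ F N θ.toStage12Params).alpha1 (gOfRecord₁₃ F N θ.toStage13Params p n)) :
    Sect2.ofBackgroundC (ιSU N) (1 : GaugeField (F.P p.K) 0 (SU N)) ∈ Sect2.spaceMS (settingOfRecord₁₃ F N θ.toStage13Params p) (θ.Rz p.K) θ.τ9.M j Y Ω :=
  Sect2.one_mem_spaceMS (settingOfRecord₁₃ F N θ.toStage13Params p) (settingOfRecord₁₃_pos F N θ.toStage13Params hθ.1.pos p) (h.rzLaws p.K) θ.τ9.M j Y Ω (fun n => (hα n).1) (fun n => (hα n).2)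

/-- (v1.7 `H` · v1.4 SEPARATED (7)-REGULAR RANGE · Co-CLASS BACKGROUND) **ROW `bg` READ OFF ON THE (2.26)–(2.27) RANGE AT THE Co-CLASS BACKGROUND OF RECORD**: in the window,
on a partition-compatible run, at a separated (2.18) index and a retained (7)-regular datum, `U_n(s)(𝐖) ∈ U^c_j(X, α_{0,j}, α_{1,j})` for every `X ∈ 𝐃_j`,
`X ⊂ Λ_j(s)`, `1 ≤ j ≤ n` (def-R `BgProvisoΛ.mem_spaceI`).  v1.4 issues NO composite reader `norm_E_bg_le_…`: the §2-form law of record (`SLaw₁₃`,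
`S218OfRecord₁₃`) is typed at §2's carrier `UbgOfRecord₁₃`, the row at `UbgOfRecord₁₃CoP`; the (2.27)(iv) composition at a v1.4 record is the
(B)-side consumer's, who supplies the form (or an agreement face) AT THIS background — logged, not asserted. [cite: Balaban1988Convergent, (2.26)–(2.28) p.259] -/
theorem bg_mem_spaceI_stage13SepCoPH {θ : Stage13HParams F N} (h : θ.Provisos₁₃SepCoPH F N) (p : B12.RunParams) (n : ℕ) (hn : n ≤ p.K)
    (hw : Step.InInterval θ.γ n (gOfRecord₁₃ F N θ.toStage13Params p)) (hpc : PartCompat₁₃ F N θ.toStage13Params p n)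
    (s : SeqOfRecord F θ.ν θ.τ9.M (gOfRecord₁₃ F N θ.toStage13Params p) p.K n) {W : B15DeterminingSets.MSField (F.P p.K) (SU N)}
    (hW : W ∈ suppOfRecord₁₃SepCoP F N θ.toStage13Params p n s) {j : ℕ} (h1 : 1 ≤ j) (hj : j ≤ n) (X : (Sect2.domSys (F.P p.K) θ.τ9.M j).Dom)
    (hX : Sect2.domSites (F.P p.K) θ.τ9.M j X ⊆ s.Λ j) :
    Sect2.ofBackgroundC (ιSU N) (UbgOfRecord₁₃CoP F N θ.toStage13Params p n s W) ∈
      Sect2.spaceI (settingOfRecord₁₃ F N θ.toStage13Params p) (θ.Rz p.K) θ.τ9.M j (Sect2.domSites (F.P p.K) θ.τ9.M j X)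
        ((lfOfRecord₁₂ F N θ.toStage12Params).alpha0 (gOfRecord₁₃ F N θ.toStage13Params p j)) ((lfOfRecord₁₂ F N θ.toStage12Params).alpha1 (gOfRecord₁₃ F N θ.toStage13Params p j)) :=
  (h.bg p n hn hw hpc).mem_spaceI s hW h1 hj X hX

/-- (v1.7 `H` · v1.4 SEPARATED (7)-REGULAR RANGE · Co-CLASS BACKGROUND) **ROW `bg` READ OFF ON THE (2.41)(i) RANGE AT THE Co-CLASS BACKGROUND OF RECORD**: same antecedents,
`U_n(s)(𝐖) ∈ Ũ^c_j(X)` for every `X ∈ 𝐃_j` meeting `Ω_j(s)` and `Z̃_j(s)` (def-R `BgProvisoΛ.mem_spaceMS`). [cite: Balaban1988Convergent, (2.41)(i) p.261, (2.28) p.259] -/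
theorem bg_mem_spaceMS_stage13SepCoPH {θ : Stage13HParams F N} (h : θ.Provisos₁₃SepCoPH F N) (p : B12.RunParams) (n : ℕ) (hn : n ≤ p.K)
    (hw : Step.InInterval θ.γ n (gOfRecord₁₃ F N θ.toStage13Params p)) (hpc : PartCompat₁₃ F N θ.toStage13Params p n)
    (s : SeqOfRecord F θ.ν θ.τ9.M (gOfRecord₁₃ F N θ.toStage13Params p) p.K n) {W : B15DeterminingSets.MSField (F.P p.K) (SU N)}
    (hW : W ∈ suppOfRecord₁₃SepCoP F N θ.toStage13Params p n s) {j : ℕ} (h1 : 1 ≤ j) (hj : j ≤ n) (X : (Sect2.domSys (F.P p.K) θ.τ9.M j).Dom)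
    (hX : (Sect2.domSites (F.P p.K) θ.τ9.M j X ∩ s.Ω j).Nonempty ∧
      (Sect2.domSites (F.P p.K) θ.τ9.M j X ∩ Sect2.enlT (F.P p.K) (Sect2.zSide (F.P p.K) θ.ν θ.τ9.M (gOfRecord₁₃ F N θ.toStage13Params p) j) 1 (s.Λ j)ᶜ).Nonempty) :
    Sect2.ofBackgroundC (ιSU N) (UbgOfRecord₁₃CoP F N θ.toStage13Params p n s W) ∈
      Sect2.spaceMS (settingOfRecord₁₃ F N θ.toStage13Params p) (θ.Rz p.K) θ.τ9.M j (Sect2.domSites (F.P p.K) θ.τ9.M j X) s.Ω :=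
  (h.bg p n hn hw hpc).mem_spaceMS s hW h1 hj X hX

/-- (v1.7 `H` · v1.4 SEPARATED (7)-REGULAR RANGE · Co-CLASS BACKGROUND) **THE (2.27)(iv) BOUND BITES AT THE BACKGROUND OF RECORD**, Stage 13, history-indexed residual ∕ weights (v1.7: row `bg` at the torus residual serves EVERY history's residual — `Stage13HParams.bgProvisoΛ_rzAt_iff`; v1.1: ON PRINT'S RANGE `X ⊂ Λ_j(s)` — one binder `hX`; v1.2: on print's SEQUENCES and partition-compatible runs — one binder `hpc`): under the provisos, IN THE
WINDOW, whenever `ρ_k` of the run has the repaired §2 form of record (`SLaw₁₃CoPH`), its witnessing 𝐄-terms obey `|𝐄^{(j)}(X, U_k(s)(𝐖), z)| ≤ E₀ exp(−κ d_j(X))`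
POINTWISE at every regular retained configuration, for every domain `X ⊂ Λ_j(s)` of the (2.26)–(2.27) sums. [cite: Balaban1988Convergent, (2.23) p.258, (2.26)–(2.28) p.259] -/
theorem norm_E_bg_le_stage13SepCoPH {θ : Stage13HParams F N} (h : θ.Provisos₁₃SepCoPH F N) (p : B12.RunParams) (k : ℕ) (hk : k ≤ p.K)
    (hw : Step.InInterval θ.γ k (gOfRecord₁₃ F N θ.toStage13Params p)) (hpc : PartCompat₁₃ F N θ.toStage13Params p k) (hS : SLaw₁₃CoPH F N θ p k) :
    ∃ t : SeqOfRecord F θ.ν θ.τ9.M (gOfRecord₁₃ F N θ.toStage13Params p) p.K k → Sect2.TermValues (F.P p.K) (MatA N) (FluctV N) θ.τ9.M,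
      Sect2.UniversalE t ∧ ∀ s Wc, Wc ∈ suppOfRecord₁₃SepCoP F N θ.toStage13Params p k s → ∀ j, 1 ≤ j → j ≤ k →
        ∀ (X : (Sect2.domSys (F.P p.K) θ.τ9.M j).Dom), Sect2.domSites (F.P p.K) θ.τ9.M j X ⊆ s.Λ j →
          ∀ (z : Site (F.P p.K) j) (g' : ℝ), 0 ≤ g' → g' ≤ (lfOfRecord₁₂ F N θ.toStage12Params).γ →
            ‖(t s).E j X z g' (Sect2.ofBackgroundC (ιSU N) (UbgOfRecord₁₃CoP F N θ.toStage13Params p k s Wc))‖ ≤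
              (lfOfRecord₁₂ F N θ.toStage12Params).E₀ * Real.exp (-(lfOfRecord₁₂ F N θ.toStage12Params).κ * (Sect2.domSys (F.P p.K) θ.τ9.M j).dj X) :=
  ((sLaw₁₃CoPH_iff F N θ p k).mp hS).norm_E_bg_le_Λ fun s₀ => (θ.bgProvisoΛ_rzAt_iff p s₀ _ _ _ _ _).mpr (h.bg p k hk hw hpc)

variable (F N)

/-! ### §11b (H). The tower and the datum of record keyed on `Provisos₁₃SepCoPH`; faces; [V] Thm 1 induction; the record predicate `IsRecordOfRecord₁₃CSepCoPH` and its refinement `.toCoPH` -/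

open Classical in
/-- (v1.7 `H` · v1.4 SEPARATED (7)-REGULAR RANGE · Co-CLASS BACKGROUND) **THE TOWER OF RECORD at `θ` under its Stage-13 provisos**, BY HAND at the Stage-13 core (`RGMachineCore.Tower`'s five fields): `ρ := densOfRecord₁₃`,
`Trho := tdensOfRecord₁₃`; the Wilson start by `rhoZero_coreOfRecord₁₃CoPH`; the push-forward obligation by def-T's `isRT_trhoOfRecord9` under the step provisos;
(0.4) at the step by `integral_densOfRecord₁₃_succ` under the INTEGRABLE-FORM `rstep` (at the classical instance). [cite: Balaban1988Convergent, (0.2) p.244, (2.18) p.257, (3.25) p.270; Balaban1989LargeFieldI, (0.4) p.176] -/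
def towerOfRecord₁₃SepCoPH (θ : Stage13HParams F N) (h : θ.Provisos₁₃SepCoPH F N) : (coreOfRecord₁₃CoPH F N θ).Tower (avOfRecord F N) where
  ρ := fun p k => densOfRecord₁₃ F N θ.toStage13Params p k
  Trho := fun p k => tdensOfRecord₁₃ F N θ.toStage13Params p k
  rho_zero := fun p => (rhoZero_coreOfRecord₁₃CoPH F N θ p).symm
  isRT_Trho := fun p k hk => isRT_trhoOfRecord9 F N θ.ν θ.τ9 (EOfRecord₁₃ F N θ.toStage13Params) (wOfRecord₉ F N θ.toStage9Params) θ.ppSel p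
    (gOfRecord₁₃ F N θ.toStage13Params p) k hk (h.tstep p k hk)
  integral_succ := fun p k hk => integral_densOfRecord₁₃_succ F N θ.toStage13Params p k (h.rstep p k hk)

/-- (v1.7 `H` · v1.4 SEPARATED (7)-REGULAR RANGE · Co-CLASS BACKGROUND) **THE DATUM OF RECORD, STAGE 13**. [cite: Balaban1989LargeFieldII, Thm 1 + (0.1) pp.355–356; Balaban1988Convergent, (0.2) p.244] -/
def datumOfRecord₁₃SepCoPH (θ : Stage13HParams F N) (h : θ.Provisos₁₃SepCoPH F N) : FiniteEpsData F (SU N) :=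
  datumOfTower F N (coreOfRecord₁₃CoPH F N θ) (towerOfRecord₁₃SepCoPH F N θ h)

/-- BRIDGE (`rfl`, proof irrelevance): the separated-range tower IS the core-keyed tower at `h.toCore`. [cite: Balaban1988Convergent, (0.2) p.244 (bookkeeping)] -/
theorem towerOfRecord₁₃SepCoPH_eq_coPH (θ : Stage13HParams F N) (h : θ.Provisos₁₃SepCoPH F N) :
    towerOfRecord₁₃SepCoPH F N θ h = towerOfRecord₁₃CoPH F N θ h.toCore := rfl

/-- BRIDGE (`rfl`): the separated-range datum IS the core-keyed datum at `h.toCore`. [cite: Balaban1989LargeFieldII, Thm 1 + (0.1) pp.355–356 (bookkeeping)] -/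
theorem datumOfRecord₁₃SepCoPH_eq_coPH (θ : Stage13HParams F N) (h : θ.Provisos₁₃SepCoPH F N) :
    datumOfRecord₁₃SepCoPH F N θ h = datumOfRecord₁₃CoPH F N θ h.toCore := rfl

/-- (v1.7 `H` · v1.4 SEPARATED (7)-REGULAR RANGE · Co-CLASS BACKGROUND) The tower's densities ARE `densOfRecord₁₃` (`rfl`). [cite: Balaban1988Convergent, (2.18) p.257 (bookkeeping)] -/
theorem towerOfRecord₁₃SepCoPH_ρ (θ : Stage13HParams F N) (h : θ.Provisos₁₃SepCoPH F N) (p : B12.RunParams) (k : ℕ) :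
    (towerOfRecord₁₃SepCoPH F N θ h).ρ p k = densOfRecord₁₃ F N θ.toStage13Params p k := rfl

/-- (v1.7 `H` · v1.4 SEPARATED (7)-REGULAR RANGE · Co-CLASS BACKGROUND) The tower's `𝐓ρ_k` ARE `tdensOfRecord₁₃` (`rfl`). [cite: Balaban1988Convergent, (3.25) p.270 (bookkeeping)] -/
theorem towerOfRecord₁₃SepCoPH_Trho (θ : Stage13HParams F N) (h : θ.Provisos₁₃SepCoPH F N) (p : B12.RunParams) (k : ℕ) :
    (towerOfRecord₁₃SepCoPH F N θ h).Trho p k = tdensOfRecord₁₃ F N θ.toStage13Params p k := rfl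

/-- (v1.7 `H` · v1.4 SEPARATED (7)-REGULAR RANGE · Co-CLASS BACKGROUND) `ρ₀` of the tower is integrable on every run: `e^{−E(p)}` times the Wilson–Boltzmann weight (`Missing.integrable_boltzmann`). [cite: Balaban1988Convergent, Thm 1 p.262 (bookkeeping)] -/
theorem integrable_towerOfRecord₁₃SepCoPH_ρ_zero (θ : Stage13HParams F N) (h : θ.Provisos₁₃SepCoPH F N) (p : B12.RunParams) :
    Integrable ((towerOfRecord₁₃SepCoPH F N θ h).ρ p 0) (fieldMeasure (F.P p.K) 0 (SU N)) := by
  rw [(towerOfRecord₁₃SepCoPH F N θ h).rho_zero p]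
  exact (Missing.integrable_boltzmann RegularGaugeGroup.measurable_reTr (F.P p.K) (sq_nonneg _)).const_mul _

open Classical in
/-- (v1.7 `H` · v1.4 SEPARATED (7)-REGULAR RANGE · Co-CLASS BACKGROUND) `ρ_{k+1}` of the tower is integrable, `k < K`: the (0.3)-density of the R-stepped pre-𝐑 slot under the integrable-form `rstep` (def-R's
`integrable_densityOfSlice_rstepSlotOfRecord_of_provisosInt`). [cite: Balaban1989LargeFieldI, (0.3)–(0.4) p.176 (bookkeeping)] -/
theorem integrable_towerOfRecord₁₃SepCoPH_ρ_succ (θ : Stage13HParams F N) (h : θ.Provisos₁₃SepCoPH F N) (p : B12.RunParams) (k : ℕ) (hk : k < p.K) :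
    Integrable ((towerOfRecord₁₃SepCoPH F N θ h).ρ p (k + 1)) (fieldMeasure (F.P p.K) (k + 1) (SU N)) := by
  rw [towerOfRecord₁₃SepCoPH_ρ, densOfRecord₁₃_succ]
  exact integrable_densityOfSlice_rstepSlotOfRecord_of_provisosInt F N θ.ν θ.τ9 _ θ.ppSel p _ (k + 1) (h.rstep p k hk)

/-- (v1.7 `H` · v1.4 SEPARATED (7)-REGULAR RANGE · Co-CLASS BACKGROUND) **THE TOWER OF RECORD IS INTEGRABLE** (`RGMachineCore.Tower.IsIntegrable`): every `ρ_k`, `k ≤ K`, from the displayed provisos alone. [cite: Balaban1988Convergent, (0.2) p.244 (bookkeeping)] -/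
theorem isIntegrable_towerOfRecord₁₃SepCoPH (θ : Stage13HParams F N) (h : θ.Provisos₁₃SepCoPH F N) : (towerOfRecord₁₃SepCoPH F N θ h).IsIntegrable
  | p, 0, _ => integrable_towerOfRecord₁₃SepCoPH_ρ_zero F N θ h p
  | p, k + 1, hk => integrable_towerOfRecord₁₃SepCoPH_ρ_succ F N θ h p k (Nat.lt_of_succ_le hk)

/-- (v1.7 `H` · v1.4 SEPARATED (7)-REGULAR RANGE · Co-CLASS BACKGROUND) … and every `𝐓ρ_k`, `k < K`, is integrable (def-T's `integrable_piece_trhoOfRecord9` summed). [cite: Balaban1988Convergent, (3.25) p.270 (bookkeeping)] -/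
theorem integrable_towerOfRecord₁₃SepCoPH_Trho (θ : Stage13HParams F N) (h : θ.Provisos₁₃SepCoPH F N) (p : B12.RunParams) (k : ℕ) (hk : k < p.K) :
    Integrable ((towerOfRecord₁₃SepCoPH F N θ h).Trho p k) (fieldMeasure (F.P p.K) (k + 1) (SU N)) :=
  integrable_finsetSum Finset.univ (fun s' _ => integrable_piece_trhoOfRecord9 F N θ.ν θ.τ9 (EOfRecord₁₃ F N θ.toStage13Params) (wOfRecord₉ F N θ.toStage9Params)
    θ.ppSel p (gOfRecord₁₃ F N θ.toStage13Params p) k hk (h.tstep p k hk) s')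

/-- (v1.7 `H` · v1.4 SEPARATED (7)-REGULAR RANGE · Co-CLASS BACKGROUND) FACE `dens` (`rfl`). [cite: Balaban1988Convergent, (2.18) p.257 (bookkeeping)] -/
theorem dens_datumOfRecord₁₃SepCoPH (θ : Stage13HParams F N) (h : θ.Provisos₁₃SepCoPH F N) (K : ℕ) (g₀ : ℝ) (k : ℕ) :
    (datumOfRecord₁₃SepCoPH F N θ h).dens K g₀ k = densOfRecord₁₃ F N θ.toStage13Params ⟨K, F.m, g₀⟩ k := rfl

/-- (v1.7 `H` · v1.4 SEPARATED (7)-REGULAR RANGE · Co-CLASS BACKGROUND) FACE `Trho` (`rfl`). [cite: Balaban1988Convergent, (3.25) p.270 (bookkeeping)] -/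
theorem trho_datumOfRecord₁₃SepCoPH (θ : Stage13HParams F N) (h : θ.Provisos₁₃SepCoPH F N) (K : ℕ) (g₀ : ℝ) (k : ℕ) :
    (datumOfRecord₁₃SepCoPH F N θ h).real.Trho K g₀ k = tdensOfRecord₁₃ F N θ.toStage13Params ⟨K, F.m, g₀⟩ k := rfl

/-- (v1.7 `H` · v1.4 SEPARATED (7)-REGULAR RANGE · Co-CLASS BACKGROUND) FACE `𝐑` (`rfl`). [cite: Balaban1989LargeFieldI, (0.2)–(0.3) p.176 (bookkeeping)] -/
theorem R_datumOfRecord₁₃SepCoPH_eq_VOfRecord₁₃CoPH (θ : Stage13HParams F N) (h : θ.Provisos₁₃SepCoPH F N) (K : ℕ) (g₀ : ℝ) (k : ℕ) :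
    (datumOfRecord₁₃SepCoPH F N θ h).real.R K g₀ k = (VOfRecord₁₃CoPH F N θ ⟨K, F.m, g₀⟩).R k := rfl

/-- (v1.7 `H` · v1.4 SEPARATED (7)-REGULAR RANGE · Co-CLASS BACKGROUND) … and maps `𝐓ρ_k ↦ ρ_{k+1}`. [cite: Balaban1988Convergent, (0.2) p.244; Balaban1989LargeFieldI, (0.3) p.176] -/
theorem R_tdens_datumOfRecord₁₃SepCoPH (θ : Stage13HParams F N) (h : θ.Provisos₁₃SepCoPH F N) (K : ℕ) (g₀ : ℝ) (k : ℕ) :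
    (datumOfRecord₁₃SepCoPH F N θ h).real.R K g₀ k (tdensOfRecord₁₃ F N θ.toStage13Params ⟨K, F.m, g₀⟩ k) =
      densOfRecord₁₃ F N θ.toStage13Params ⟨K, F.m, g₀⟩ (k + 1) :=
  (towerOfRecord₁₃SepCoPH F N θ h).inducedR_Trho ⟨K, F.m, g₀⟩ k

/-- (v1.7 `H` · v1.4 SEPARATED (7)-REGULAR RANGE · Co-CLASS BACKGROUND) FACE construction (`rfl`). [cite: Balaban1989LargeFieldII, Thm 1 + (0.1) pp.355–356 (bookkeeping)] -/
theorem datumOfRecord₁₃SepCoPH_C (θ : Stage13HParams F N) (h : θ.Provisos₁₃SepCoPH F N) :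
    (datumOfRecord₁₃SepCoPH F N θ h).C = (coreOfRecord₁₃CoPH F N θ).construction (densOfRecord₁₃ F N θ.toStage13Params) := rfl

/-- (v1.7 `H` · v1.4 SEPARATED (7)-REGULAR RANGE · Co-CLASS BACKGROUND) FACE β: the datum's β-functions ARE `betaOfRecord₁₃ θ` (`rfl`). [cite: Balaban1987RG1, (1.20)–(1.22) p.264 (bookkeeping)] -/
theorem βfun_datumOfRecord₁₃SepCoPH (θ : Stage13HParams F N) (h : θ.Provisos₁₃SepCoPH F N) :
    (datumOfRecord₁₃SepCoPH F N θ h).βfun = betaOfRecord₁₃ F N θ.toStage13Params := rfl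

/-- (v1.7 `H` · v1.4 SEPARATED (7)-REGULAR RANGE · Co-CLASS BACKGROUND) … i.e. the χ-generic β at `T := TcanOfRecord`, `χ := chiFixed29 θ.ν θ.ε₂₉` (`rfl`). [cite: Balaban1987RG1, (1.20)–(1.22) p.264, (2.9) p.266 (bookkeeping)] -/
theorem βfun_datumOfRecord₁₃SepCoPH_eq_betaOfRecord₈Tχ (θ : Stage13HParams F N) (h : θ.Provisos₁₃SepCoPH F N) :
    (datumOfRecord₁₃SepCoPH F N θ h).βfun = betaOfRecord₈Tχ F N (TcanOfRecord F N) (chiFixed29 F N θ.ν θ.ε₂₉) θ.toStage8Params := rfl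

/-- (v1.7 `H` · v1.4 SEPARATED (7)-REGULAR RANGE · Co-CLASS BACKGROUND) FACE flow (`rfl`). [cite: Balaban1987RG1, (0.17)–(0.20) pp.255–256 (bookkeeping)] -/
theorem flow_g_datumOfRecord₁₃SepCoPH (θ : Stage13HParams F N) (h : θ.Provisos₁₃SepCoPH F N) (p : B12.RunParams) :
    ((datumOfRecord₁₃SepCoPH F N θ h).C p).flow.g = gOfRecord₁₃ F N θ.toStage13Params p := rfl

/-- (v1.7 `H` · v1.4 SEPARATED (7)-REGULAR RANGE · Co-CLASS BACKGROUND) FACE av (`rfl`). [cite: Balaban1987RG1, (0.4) p.253 (bookkeeping)] -/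
theorem av_datumOfRecord₁₃SepCoPH (θ : Stage13HParams F N) (h : θ.Provisos₁₃SepCoPH F N) : (datumOfRecord₁₃SepCoPH F N θ h).av = avOfRecord F N := rfl

/-- (v1.7 `H` · v1.4 SEPARATED (7)-REGULAR RANGE · Co-CLASS BACKGROUND) STAGE-0 DATUM CLAUSE at the Stage-13 datum (`rfl`). [cite: Balaban1987RG1, (0.3)–(0.4) p.253] -/
theorem isDatumOfRecord₀_datumOfRecord₁₃SepCoPH (θ : Stage13HParams F N) (h : θ.Provisos₁₃SepCoPH F N) : IsDatumOfRecord₀ F N (datumOfRecord₁₃SepCoPH F N θ h) := rfl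

/-- (v1.7 `H` · v1.4 SEPARATED (7)-REGULAR RANGE · Co-CLASS BACKGROUND) BINDER B1 = NODE N23 at the Stage-13 datum. [cite: Balaban1987RG1, (0.4) p.253] -/
theorem isPrintedAveraged_datumOfRecord₁₃SepCoPH (θ : Stage13HParams F N) (h : θ.Provisos₁₃SepCoPH F N) : (datumOfRecord₁₃SepCoPH F N θ h).IsPrintedAveraged :=
  isPrintedAveraged_datumOfTower F N _ _

/-- (v1.7 `H` · v1.4 SEPARATED (7)-REGULAR RANGE · Co-CLASS BACKGROUND) FACE χ ∕ actions ∕ `IndAss` ∕ `Repr`: the Stage-13 core's fields (`rfl`). [cite: Balaban1987RG1, (0.17)–(0.24) pp.255–257 (bookkeeping)] -/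
theorem actionSide_stage13SepCoPH (θ : Stage13HParams F N) (h : θ.Provisos₁₃SepCoPH F N) (p : B12.RunParams) (k : ℕ) :
    ((datumOfRecord₁₃SepCoPH F N θ h).C p).χ k = (coreOfRecord₁₃CoPH F N θ).χ p k ∧
      ((datumOfRecord₁₃SepCoPH F N θ h).C p).effAction k = (coreOfRecord₁₃CoPH F N θ).effAction p k ∧
        ((datumOfRecord₁₃SepCoPH F N θ h).C p).Ek k = (coreOfRecord₁₃CoPH F N θ).Ek p k ∧
          (((datumOfRecord₁₃SepCoPH F N θ h).C p).IndAss k ↔ (coreOfRecord₁₃CoPH F N θ).IndAss p k) ∧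
            (((datumOfRecord₁₃SepCoPH F N θ h).C p).Repr k ↔ (coreOfRecord₁₃CoPH F N θ).Repr p k) :=
  ⟨rfl, rfl, rfl, Iff.rfl, Iff.rfl⟩

/-- (v1.7 `H` · v1.4 SEPARATED (7)-REGULAR RANGE · Co-CLASS BACKGROUND) **FACE `Sect2Form`**: the construction's §2 [III] clause at step `k` IS the repaired §2 form of the post-𝐑 slot family of `ρ_k`, Stage 13.
[cite: Balaban1988Convergent, (2.17)–(2.18) p.257, (2.23)–(2.42) pp.258–261, Thm 1 p.262] -/
theorem sect2Form_stage13SepCoPH_iff (θ : Stage13HParams F N) (h : θ.Provisos₁₃SepCoPH F N) (p : B12.RunParams) (k : ℕ) :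
    ((datumOfRecord₁₃SepCoPH F N θ h).C p).Sect2Form k ↔
      HasSect2FormAEZS F N (FluctV N) p.K (settingOfRecord₁₃ F N θ.toStage13Params p) k (θ.rzAt p) (WtOfRecord₁₃H F N θ p)
        (UbgOfRecord₁₃CoP F N θ.toStage13Params p k)
        (slotsOfRecord F N θ.ν θ.τ9 (EOfRecord₁₃ F N θ.toStage13Params) (wOfRecord₉ F N θ.toStage9Params) θ.ppSel p
          (gOfRecord₁₃ F N θ.toStage13Params p) k) :=
  sLaw₁₃CoPH_iff F N θ p k

/-- (v1.7 `H` · v1.4 SEPARATED (7)-REGULAR RANGE · Co-CLASS BACKGROUND) (2.18) holds for the datum's densities with `rep_k` of record, by construction. [cite: Balaban1988Convergent, (2.18) p.257] -/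
theorem holds_dens_datumOfRecord₁₃SepCoPH (θ : Stage13HParams F N) (h : θ.Provisos₁₃SepCoPH F N) (K : ℕ) (g₀ : ℝ) (k : ℕ) :
    (reprOfRecord₁₃ F N θ.toStage13Params ⟨K, F.m, g₀⟩ k).Holds ((datumOfRecord₁₃SepCoPH F N θ h).dens K g₀ k) :=
  holds_densOfRecord₁₃ F N θ.toStage13Params _ k

/-- (v1.7 `H` · v1.4 SEPARATED (7)-REGULAR RANGE · Co-CLASS BACKGROUND) FACE Wilson start. [cite: Balaban1988Convergent, Thm 1 p.262] -/
theorem dens_zero_datumOfRecord₁₃SepCoPH (θ : Stage13HParams F N) (h : θ.Provisos₁₃SepCoPH F N) (K : ℕ) (g₀ : ℝ) :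
    (datumOfRecord₁₃SepCoPH F N θ h).dens K g₀ 0 = rhoZeroOfRecord F N K g₀ (EOfRecord₁₃ F N θ.toStage13Params ⟨K, F.m, g₀⟩) :=
  densOfRecord₁₃_zero F N θ.toStage13Params ⟨K, F.m, g₀⟩

/-- (v1.7 `H` · v1.4 SEPARATED (7)-REGULAR RANGE · Co-CLASS BACKGROUND) FACE push-forward: `𝐓ρ_k` IS an averaging-of-record image of `ρ_k` (`k < K`). [cite: Balaban1988Convergent, (3.1) p.264, (3.24)–(3.25) p.270] -/
theorem isRT_trho_datumOfRecord₁₃SepCoPH (θ : Stage13HParams F N) (h : θ.Provisos₁₃SepCoPH F N) (K : ℕ) (g₀ : ℝ) (k : ℕ) (hk : k < K) :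
    IsRT (avOfRecord F N K k).avg ((datumOfRecord₁₃SepCoPH F N θ h).dens K g₀ k) ((datumOfRecord₁₃SepCoPH F N θ h).real.Trho K g₀ k) :=
  (towerOfRecord₁₃SepCoPH F N θ h).isRT_Trho ⟨K, F.m, g₀⟩ k hk

/-- (v1.7 `H` · v1.4 SEPARATED (7)-REGULAR RANGE · Co-CLASS BACKGROUND) FACE (0.4) at the step: `∫ρ_{k+1} = ∫𝐓ρ_k` (`k < K`). [cite: Balaban1989LargeFieldI, (0.4) p.176] -/
theorem integral_dens_succ_datumOfRecord₁₃SepCoPH (θ : Stage13HParams F N) (h : θ.Provisos₁₃SepCoPH F N) (K : ℕ) (g₀ : ℝ) (k : ℕ) (hk : k < K) :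
    ∫ V, (datumOfRecord₁₃SepCoPH F N θ h).dens K g₀ (k + 1) V ∂fieldMeasure (F.P K) (k + 1) (SU N)
      = ∫ V, (datumOfRecord₁₃SepCoPH F N θ h).real.Trho K g₀ k V ∂fieldMeasure (F.P K) (k + 1) (SU N) :=
  (towerOfRecord₁₃SepCoPH F N θ h).integral_succ ⟨K, F.m, g₀⟩ k hk

/-- (v1.7 `H` · v1.4 SEPARATED (7)-REGULAR RANGE · Co-CLASS BACKGROUND) `∫ρ_k = ∫ρ₀` along every run, `k ≤ K`. [cite: Balaban1985UV3, (6) p.257] -/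
theorem integral_dens_eq_zero_datumOfRecord₁₃SepCoPH (θ : Stage13HParams F N) (h : θ.Provisos₁₃SepCoPH F N) (K : ℕ) (g₀ : ℝ) (k : ℕ) (hk : k ≤ K) :
    ∫ V, (datumOfRecord₁₃SepCoPH F N θ h).dens K g₀ k V ∂fieldMeasure (F.P K) k (SU N)
      = ∫ U, (datumOfRecord₁₃SepCoPH F N θ h).dens K g₀ 0 U ∂fieldMeasure (F.P K) 0 (SU N) :=
  (towerOfRecord₁₃SepCoPH F N θ h).integral_eq_integral_zero ⟨K, F.m, g₀⟩ k hk

/-- (v1.7 `H` · v1.4 SEPARATED (7)-REGULAR RANGE · Co-CLASS BACKGROUND) FACE integrability: every density of the datum, `k ≤ K`, is integrable. [cite: Balaban1988Convergent, (0.2) p.244 (bookkeeping)] -/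
theorem integrable_dens_datumOfRecord₁₃SepCoPH (θ : Stage13HParams F N) (h : θ.Provisos₁₃SepCoPH F N) (K : ℕ) (g₀ : ℝ) (k : ℕ) (hk : k ≤ K) :
    Integrable ((datumOfRecord₁₃SepCoPH F N θ h).dens K g₀ k) (fieldMeasure (F.P K) k (SU N)) :=
  isIntegrable_towerOfRecord₁₃SepCoPH F N θ h ⟨K, F.m, g₀⟩ k hk

/-- (v1.7 `H` · v1.4 SEPARATED (7)-REGULAR RANGE · Co-CLASS BACKGROUND) … and so is every realised `𝐓ρ_k`, `k < K`. [cite: Balaban1988Convergent, (3.25) p.270 (bookkeeping)] -/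
theorem integrable_trho_datumOfRecord₁₃SepCoPH (θ : Stage13HParams F N) (h : θ.Provisos₁₃SepCoPH F N) (K : ℕ) (g₀ : ℝ) (k : ℕ) (hk : k < K) :
    Integrable ((datumOfRecord₁₃SepCoPH F N θ h).real.Trho K g₀ k) (fieldMeasure (F.P K) (k + 1) (SU N)) :=
  integrable_towerOfRecord₁₃SepCoPH_Trho F N θ h ⟨K, F.m, g₀⟩ k hk

/-- (v1.7 `H` · v1.4 SEPARATED (7)-REGULAR RANGE · Co-CLASS BACKGROUND) The T⁴ apex at the Stage-13 datum, B1 eliminated. [cite: JaffeWittenClay2006, §6.5 p.11] -/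
theorem continuumYM4Torus_datumOfRecord₁₃SepCoPH (θ : Stage13HParams F N) (h : θ.Provisos₁₃SepCoPH F N)
    (hB : B16.EndStatementBPrinted (datumOfRecord₁₃SepCoPH F N θ h).C)
    (hE : EndpointExistence (datumOfRecord₁₃SepCoPH F N θ h).C.toB12)
    (hNE : T4ApexHybrid.HybridNE7Under (datumOfRecord₁₃SepCoPH F N θ h) (EndpointExistence (datumOfRecord₁₃SepCoPH F N θ h).C.toB12)) :
    T4ContinuumYM4Torus.ContinuumYM4Torus (datumOfRecord₁₃SepCoPH F N θ h) :=
  continuumYM4Torus_datumOfTower F N _ _ hB hE hNE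

/-- (v1.7 `H` · v1.4 SEPARATED (7)-REGULAR RANGE · Co-CLASS BACKGROUND) **THE BASE HOLDS** on every run of the Stage-13 datum (`sLaw₁₃CoPH_zero`). [cite: Balaban1988Convergent, Thm 1 p.262; Balaban1989LargeFieldII, Thm 1 p.355 (bookkeeping)] -/
theorem sect2Form_zero_datumOfRecord₁₃SepCoPH (θ : Stage13HParams F N) (h : θ.Provisos₁₃SepCoPH F N) (P : B12.RunParams) :
    ((datumOfRecord₁₃SepCoPH F N θ h).C P).Sect2Form 0 :=
  (sect2Form_stage13SepCoPH_iff F N θ h P 0).mpr ((sLaw₁₃CoPH_iff F N θ P 0).mp (sLaw₁₃CoPH_zero F N θ P))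

/-- (v1.7 `H` · v1.4 SEPARATED (7)-REGULAR RANGE · Co-CLASS BACKGROUND) **`B16.InductionBase` AT THE STAGE-13 DATUM, for every window letter `γ`, NO hypothesis.** [cite: Balaban1988Convergent, Thm 1 p.262; Balaban1989LargeFieldII, Thm 1 p.355 + p.391] -/
theorem inductionBase_datumOfRecord₁₃SepCoPH (θ : Stage13HParams F N) (h : θ.Provisos₁₃SepCoPH F N) (γ : ℝ) : B16.InductionBase (datumOfRecord₁₃SepCoPH F N θ h).C γ :=
  fun P _ => sect2Form_zero_datumOfRecord₁₃SepCoPH F N θ h P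

/-- (v1.7 `H` · v1.4 SEPARATED (7)-REGULAR RANGE · Co-CLASS BACKGROUND) **THE STEP OF THEOREM 1 AT THE OBJECTS OF RECORD, Stage 13**: along every run in the `γ`-window, from the 𝐓-STEP LAW «`SLaw₁₃CoPH k → TLaw₁₃CoPH k`» and the 𝐑-LEAF
`ROpLeaf (VOfRecord₁₃CoPH θ P)`.  Both hypotheses DISPLAYED. [cite: Balaban1989LargeFieldII, Thm 1 p.355 and pp.390–391; Balaban1988Convergent, Thm p.245, Thm 2 p.263] -/
theorem inductionStep_datumOfRecord₁₃SepCoPH_of_tLaw_rOpLeaf (θ : Stage13HParams F N) (h : θ.Provisos₁₃SepCoPH F N) (γ : ℝ)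
    (hT : ∀ P : B12.RunParams, ((datumOfRecord₁₃SepCoPH F N θ h).C P).flow.InInterval γ P.K →
      ∀ k, k < P.K → SLaw₁₃CoPH F N θ P k → TLaw₁₃CoPH F N θ P k)
    (hR : ∀ P : B12.RunParams, ((datumOfRecord₁₃SepCoPH F N θ h).C P).flow.InInterval γ P.K → ROpLeaf (VOfRecord₁₃CoPH F N θ P)) :
    B16.InductionStep (datumOfRecord₁₃SepCoPH F N θ h).C γ := by
  intro P hP k hk hS
  have hS' : SLaw₁₃CoPH F N θ P k := (sLaw₁₃CoPH_iff F N θ P k).mpr ((sect2Form_stage13SepCoPH_iff F N θ h P k).mp hS)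
  exact (sect2Form_stage13SepCoPH_iff F N θ h P (k + 1)).mpr
    ((sLaw₁₃CoPH_iff F N θ P (k + 1)).mp ((rOpLeaf_VOfRecord₁₃CoPH_iff F N θ P).mp (hR P hP) k hk (hT P hP k hk hS')))

/-- (v1.7 `H` · v1.4 SEPARATED (7)-REGULAR RANGE · Co-CLASS BACKGROUND) **[V] THEOREM 1 AT THE STAGE-13 DATUM FROM ITS PRINTED PIECES WITHOUT A BASE HYPOTHESIS.** [cite: Balaban1989LargeFieldII, Thm 1 p.355 + p.391; Balaban1988Convergent, Thm 1 p.262, Thm p.245, Thm 2 p.263] -/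
theorem thm1Printed_datumOfRecord₁₃SepCoPH_of_tLaw_rOpLeaf (θ : Stage13HParams F N) (h : θ.Provisos₁₃SepCoPH F N) {γ : ℝ} (hγ : 0 < γ)
    (hT : ∀ P : B12.RunParams, ((datumOfRecord₁₃SepCoPH F N θ h).C P).flow.InInterval γ P.K →
      ∀ k, k < P.K → SLaw₁₃CoPH F N θ P k → TLaw₁₃CoPH F N θ P k)
    (hR : ∀ P : B12.RunParams, ((datumOfRecord₁₃SepCoPH F N θ h).C P).flow.InInterval γ P.K → ROpLeaf (VOfRecord₁₃CoPH F N θ P)) :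
    B16.Thm1Printed (datumOfRecord₁₃SepCoPH F N θ h).C :=
  B16.thm1_of_steps _ γ hγ (inductionBase_datumOfRecord₁₃SepCoPH F N θ h γ) (inductionStep_datumOfRecord₁₃SepCoPH_of_tLaw_rOpLeaf F N θ h γ hT hR)

/-- (v1.7 `H` · v1.4 SEPARATED (7)-REGULAR RANGE · Co-CLASS BACKGROUND) **«(D, w) is the record, Stage 13»**: admissible Stage-13 parameters SATISFYING THE STAGE-13 PROVISOS whose Stage-13 datum of record IS `D`, and a world bound
to its construction with a window `0 < w.γ ≤ θ.γ`, Bałaban's block size and the C-binding of record over the Stage-13 view. [cite: Balaban1989LargeFieldII, Thm 1 + (0.1) pp.355–356; Balaban1988Convergent, (0.2) p.244, (2.17)–(2.18) p.257, Thms 1–2 pp.262–263; Balaban1989LargeFieldI, (0.2)–(0.4) p.176; Balaban1987RG1, p.259 (objects of record; bookkeeping)] -/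
def IsRecordOfRecord₁₃CSepCoPH (D : FiniteEpsData F (SU N)) (w : WorldP) : Prop :=
  ∃ (θ : Stage13HParams F N) (h : θ.Provisos₁₃SepCoPH F N), θ.Admissible F N ∧ D = datumOfRecord₁₃SepCoPH F N θ h ∧ w.C = D.C ∧ (0 < w.γ ∧ w.γ ≤ θ.γ) ∧
    w.L = (θ.L : ℝ) ∧ ∀ P : B12.RunParams, w.up P = upOfRecord₅C F N (θ.toStage5₁₃CoPH F N) P

/-- (v1.7 `H` · v1.4 SEPARATED (7)-REGULAR RANGE · Co-CLASS BACKGROUND) **Pointed form**. [cite: Balaban1989LargeFieldII, Thm 1 + (0.1) pp.355–356 (bookkeeping)] -/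
theorem isRecordOfRecord₁₃CSepCoPH_of_eq (θ : Stage13HParams F N) (h : θ.Provisos₁₃SepCoPH F N) (hθ : θ.Admissible F N) (w : WorldP)
    (hC : w.C = (datumOfRecord₁₃SepCoPH F N θ h).C) (hγ : 0 < w.γ ∧ w.γ ≤ θ.γ) (hL : w.L = (θ.L : ℝ))
    (hup : ∀ P, w.up P = upOfRecord₅C F N (θ.toStage5₁₃CoPH F N) P) :
    IsRecordOfRecord₁₃CSepCoPH F N (datumOfRecord₁₃SepCoPH F N θ h) w :=
  ⟨θ, h, hθ, rfl, hC, hγ, hL, hup⟩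

/-- (v1.7 `H` · v1.4 SEPARATED (7)-REGULAR RANGE · Co-CLASS BACKGROUND) **Every admissible Stage-12 parameter satisfying the Stage-13 provisos IS a Stage-13 record at some world**, with any window `0 < γw ≤ θ.γ`.
[cite: Balaban1989LargeFieldII, Thm 1 + (0.1) pp.355–356 (bookkeeping)] -/
theorem exists_world_isRecordOfRecord₁₃CSepCoPH (θ : Stage13HParams F N) (h : θ.Provisos₁₃SepCoPH F N) (hθ : θ.Admissible F N) {γw : ℝ} (hγw : 0 < γw ∧ γw ≤ θ.γ) :
    ∃ w : WorldP, IsRecordOfRecord₁₃CSepCoPH F N (datumOfRecord₁₃SepCoPH F N θ h) w ∧ w.γ = γw := by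
  obtain ⟨w₀⟩ := nonempty_worldP
  exact ⟨{ w₀ with
      C := (datumOfRecord₁₃SepCoPH F N θ h).C, γ := γw, L := (θ.L : ℝ), one_lt_L := by exact_mod_cast θ.hL.2,
      up := fun P => upOfRecord₅C F N (θ.toStage5₁₃CoPH F N) P },
    ⟨θ, h, hθ, rfl, rfl, hγw, rfl, fun _ => rfl⟩, rfl⟩

variable {F N} in
/-- **EVERY v1.4 RECORD IS A Co CORE RECORD** (along `Provisos₁₃SepCoPH.toCore`, same datum by `rfl`; FILE 21's core record family `IsRecordOfRecord₁₃CCoPH`) — the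
one-way projection by which every storey keyed ONCE on `Provisos₁₃CoPH ∕ datumOfRecord₁₃CoPH ∕ IsRecordOfRecord₁₃CCoPH` serves a v1.4 record.  There is NO
bridge out of the core and NONE from or to the U_old provisos `Provisos₁₃ ∕ Provisos₁₃Sep ∕ Provisos₁₃SepMixed` (their `bg` and datum read `UbgOfRecord₁₃`).
[cite: Balaban1989LargeFieldII, Thm 1 + (0.1) pp.355–356 (bookkeeping)] -/
theorem IsRecordOfRecord₁₃CSepCoPH.toCoPH {D : FiniteEpsData F (SU N)} {w : WorldP} (h : IsRecordOfRecord₁₃CSepCoPH F N D w) :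
    IsRecordOfRecord₁₃CCoPH F N D w := by
  obtain ⟨θ, hP, hθ, hD, hC, hγ, hL, hup⟩ := h
  exact ⟨θ, hP.toCore, hθ, hD, hC, hγ, hL, hup⟩

section ConsequencesSepCoPH

variable {F N}
variable {D : FiniteEpsData F (SU N)} {w : WorldP}

/-- (v1.7 `H` · v1.4 SEPARATED (7)-REGULAR RANGE · Co-CLASS BACKGROUND) A Stage-13 record CERTIFIES its parameters' provisos and admissibility. [cite: Balaban1989LargeFieldI, (0.3)–(0.4) p.176 (bookkeeping)] -/
theorem exists_provisos_of_isRecordOfRecord₁₃CSepCoPH (h : IsRecordOfRecord₁₃CSepCoPH F N D w) :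
    ∃ (θ : Stage13HParams F N) (hP : θ.Provisos₁₃SepCoPH F N), θ.Admissible F N ∧ D = datumOfRecord₁₃SepCoPH F N θ hP := by
  obtain ⟨θ, hP, hθ, hD, -⟩ := h
  exact ⟨θ, hP, hθ, hD⟩

/-- (v1.7 `H` · v1.4 SEPARATED (7)-REGULAR RANGE · Co-CLASS BACKGROUND) Binding clause 1: the world's construction IS the datum's. [cite: Balaban1989LargeFieldII, Thm 1 p.355 (bookkeeping)] -/
theorem construction_eq_of_isRecordOfRecord₁₃CSepCoPH (h : IsRecordOfRecord₁₃CSepCoPH F N D w) : w.C = D.C := by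
  obtain ⟨θ, hP, -, -, hC, -⟩ := h
  exact hC

/-- (v1.7 `H` · v1.4 SEPARATED (7)-REGULAR RANGE · Co-CLASS BACKGROUND) Binding clause 2: the interval constant is positive. [cite: Balaban1989LargeFieldII, Thm 1 p.355 (bookkeeping)] -/
theorem gamma_pos_of_isRecordOfRecord₁₃CSepCoPH (h : IsRecordOfRecord₁₃CSepCoPH F N D w) : 0 < w.γ := by
  obtain ⟨θ, hP, -, -, -, hγ, -⟩ := h
  exact hγ.1

/-- (v1.7 `H` · v1.4 SEPARATED (7)-REGULAR RANGE · Co-CLASS BACKGROUND) A Stage-13 record's datum is a datum of record, Stage 0. [cite: Balaban1987RG1, (0.3)–(0.4) p.253 (bookkeeping)] -/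
theorem isDatumOfRecord₀_of_isRecordOfRecord₁₃CSepCoPH (h : IsRecordOfRecord₁₃CSepCoPH F N D w) : IsDatumOfRecord₀ F N D := by
  obtain ⟨θ, hP, -, rfl, -⟩ := h
  exact isDatumOfRecord₀_datumOfRecord₁₃SepCoPH F N θ hP

/-- (v1.7 `H` · v1.4 SEPARATED (7)-REGULAR RANGE · Co-CLASS BACKGROUND) N23 · binder B1 at every Stage-13 record. [cite: Balaban1987RG1, (0.4) p.253] -/
theorem isPrintedAveraged_of_isRecordOfRecord₁₃CSepCoPH (h : IsRecordOfRecord₁₃CSepCoPH F N D w) : D.IsPrintedAveraged :=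
  isPrintedAveraged_of_isDatumOfRecord₀ F N D (isDatumOfRecord₀_of_isRecordOfRecord₁₃CSepCoPH h)

/-- (v1.7 `H` · v1.4 SEPARATED (7)-REGULAR RANGE · Co-CLASS BACKGROUND) **A Stage-13 record's 𝐑-leaf IS «repaired 𝐓-image form ⇒ repaired §2 form one level up» along its tower of record**, at every run.
[cite: Balaban1988Convergent, p.244, Thm 2 p.263; Balaban1989LargeFieldII, Thm 1 p.355 (bookkeeping)] -/
theorem exists_rOperation_iff_of_isRecordOfRecord₁₃CSepCoPH (h : IsRecordOfRecord₁₃CSepCoPH F N D w) :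
    ∃ (θ : Stage13HParams F N) (hP : θ.Provisos₁₃SepCoPH F N), θ.Admissible F N ∧ D = datumOfRecord₁₃SepCoPH F N θ hP ∧
      ∀ P : B12.RunParams, (leavesP w P).rOperation ↔ ∀ k, k < P.K → TLaw₁₃CoPH F N θ P k → SLaw₁₃CoPH F N θ P (k + 1) := by
  obtain ⟨θ, hP, hθ, hD, -, -, -, hup⟩ := h
  refine ⟨θ, hP, hθ, hD, fun P => ?_⟩
  show (w.up P).rOperation ↔ _
  rw [hup P]
  exact rOperation_upOfRecord₅C_stage13CoPH_iff F N θ P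

/-- (v1.7 `H` · v1.4 SEPARATED (7)-REGULAR RANGE · Co-CLASS BACKGROUND) **AT A STAGE-13 RECORD WHOSE 𝐑-LEAVES HOLD, EVERY `ρ_{k+1}` WHOSE `𝐓ρ_k` HAS THE 𝐓-IMAGE FORM HAS THE REPAIRED §2 FORM OF RECORD.**
[cite: Balaban1988Convergent, Thm 2 p.263, (2.18) p.257, (2.23) p.258 (bookkeeping)] -/
theorem hasSect2FormAEZS_succ_of_isRecordOfRecord₁₃CSepCoPH (h : IsRecordOfRecord₁₃CSepCoPH F N D w) (hR : ∀ P : B12.RunParams, (leavesP w P).rOperation) :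
    ∃ (θ : Stage13HParams F N) (hP : θ.Provisos₁₃SepCoPH F N), θ.Admissible F N ∧ D = datumOfRecord₁₃SepCoPH F N θ hP ∧
      ∀ (P : B12.RunParams) (k : ℕ), k < P.K → TLaw₁₃CoPH F N θ P k →
        HasSect2FormAEZS F N (FluctV N) P.K (settingOfRecord₁₃ F N θ.toStage13Params P) (k + 1) (θ.rzAt P) (WtOfRecord₁₃H F N θ P)
          (UbgOfRecord₁₃CoP F N θ.toStage13Params P (k + 1))
          (slotsOfRecord F N θ.ν θ.τ9 (EOfRecord₁₃ F N θ.toStage13Params) (wOfRecord₉ F N θ.toStage9Params) θ.ppSel P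
            (gOfRecord₁₃ F N θ.toStage13Params P) (k + 1)) := by
  obtain ⟨θ, hP, hθ, hD, hrop⟩ := exists_rOperation_iff_of_isRecordOfRecord₁₃CSepCoPH h
  exact ⟨θ, hP, hθ, hD, fun P k hk hT => (sLaw₁₃CoPH_iff F N θ P (k + 1)).mp (((hrop P).mp (hR P)) k hk hT)⟩

/-- (v1.7 `H` · v1.4 SEPARATED (7)-REGULAR RANGE · Co-CLASS BACKGROUND) **AT A STAGE-13 RECORD WHOSE 𝐑-LEAVES HOLD, [V] THEOREM 1 FOLLOWS FROM THE 𝐓-STEP LAW ALONE** (any window letter `γ > 0`).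
[cite: Balaban1989LargeFieldII, Thm 1 p.355 + p.391; Balaban1988Convergent, Thm 1 p.262, Thm p.245, Thm 2 p.263 (bookkeeping)] -/
theorem thm1Printed_of_isRecordOfRecord₁₃CSepCoPH_of_tLaw (h : IsRecordOfRecord₁₃CSepCoPH F N D w) (hR : ∀ P : B12.RunParams, (leavesP w P).rOperation) :
    ∃ (θ : Stage13HParams F N) (hP : θ.Provisos₁₃SepCoPH F N), θ.Admissible F N ∧ D = datumOfRecord₁₃SepCoPH F N θ hP ∧
      ∀ γ : ℝ, 0 < γ → (∀ P : B12.RunParams, (D.C P).flow.InInterval γ P.K → ∀ k, k < P.K → SLaw₁₃CoPH F N θ P k → TLaw₁₃CoPH F N θ P k) →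
        B16.Thm1Printed D.C := by
  obtain ⟨θ, hP, hθ, hD, hrop⟩ := exists_rOperation_iff_of_isRecordOfRecord₁₃CSepCoPH h
  refine ⟨θ, hP, hθ, hD, fun γ hγ hT => ?_⟩
  subst hD
  exact thm1Printed_datumOfRecord₁₃SepCoPH_of_tLaw_rOpLeaf F N θ hP hγ hT
    (fun P _ => (rOpLeaf_VOfRecord₁₃CoPH_iff F N θ P).mpr ((hrop P).mp (hR P)))

end ConsequencesSepCoPH

/-! ### §11c (H). The shadow keyed on `Provisos₁₃SepCoPH`; refinement to the Stage-5 record predicate; transfer of world-reading theorems; β-layer faces -/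

/-- (v1.7 `H` · v1.4 SEPARATED (7)-REGULAR RANGE · Co-CLASS BACKGROUND) **THE SHADOW RESIDUAL of `θ` under its Stage-13 provisos** (as FILE 12b: `R :=` the induced operation at the Radon–Nikodym image of the tower of record, the
format slot FROZEN at the density of record).  A PROOF DEVICE. [cite: Balaban1989LargeFieldI, (0.2)–(0.4) p.176; Balaban1987RG1, (0.13) p.254 (bookkeeping)] -/
def shadowResidual₁₃SepCoPH (θ : Stage13HParams F N) (h : θ.Provisos₁₃SepCoPH F N) : Residual₅ F N :=
  { residualOfStage13CoPH F N θ with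
    R := fun p k => (towerOfRecord₁₃SepCoPH F N θ h).shadowR p k
    preservesIntegral_R := fun p k hk => (towerOfRecord₁₃SepCoPH F N θ h).preservesIntegral_shadowR p k hk (avOfRecord_measurable F N p.K k)
      (avOfRecord_haarAC F N p.K k hk) (isIntegrable_towerOfRecord₁₃SepCoPH F N θ h p k hk.le)
    integrable_R := fun p k hk => (towerOfRecord₁₃SepCoPH F N θ h).integrable_shadowR p k
      (isIntegrable_towerOfRecord₁₃SepCoPH F N θ h p (k + 1) (Nat.succ_le_of_lt hk))
    S218 := fun p k _ => S218OfRecord₁₃CoPH F N θ p k (densOfRecord₁₃ F N θ.toStage13Params p k) }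

/-- (v1.7 `H` · v1.4 SEPARATED (7)-REGULAR RANGE · Co-CLASS BACKGROUND) **THE SHADOW Stage-5 parameters of `θ`** at interval letter `γ'`. [cite: Balaban1989LargeFieldI, (0.2) p.176 (bookkeeping)] -/
def shadow₅OfRecord₁₃SepCoPH (θ : Stage13HParams F N) (h : θ.Provisos₁₃SepCoPH F N) (γ' : ℝ) : Stage5Params F N :=
  { θ.toStage5Params with γ := γ', res := shadowResidual₁₃SepCoPH F N θ h }

/-- (v1.7 `H` · v1.4 SEPARATED (7)-REGULAR RANGE · Co-CLASS BACKGROUND) THE KEY `rfl`: the machine of the shadow has core `coreOfRecord₁₃CoPH θ`. [cite: Balaban1988Convergent, (0.2) p.244 (bookkeeping)] -/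
theorem toCore_machineOfRecord₅_shadow₁₃SepCoPH (θ : Stage13HParams F N) (h : θ.Provisos₁₃SepCoPH F N) (γ' : ℝ) :
    (machineOfRecord₅ F N (shadow₅OfRecord₁₃SepCoPH F N θ h γ')).toCore = coreOfRecord₁₃CoPH F N θ := rfl

/-- (v1.7 `H` · v1.4 SEPARATED (7)-REGULAR RANGE · Co-CLASS BACKGROUND) The shadow's residual `R` IS the tower's shadow operation (`rfl`). [cite: Balaban1989LargeFieldI, (0.3) p.176 (bookkeeping)] -/
theorem res_R_shadow₁₃SepCoPH (θ : Stage13HParams F N) (h : θ.Provisos₁₃SepCoPH F N) (γ' : ℝ) (p : B12.RunParams) (k : ℕ) :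
    (shadow₅OfRecord₁₃SepCoPH F N θ h γ').res.R p k = (towerOfRecord₁₃SepCoPH F N θ h).shadowR p k := rfl

/-- (v1.7 `H` · v1.4 SEPARATED (7)-REGULAR RANGE · Co-CLASS BACKGROUND) The shadow is Stage-5 admissible iff `θ`'s Stage-1 dictionary is admissible and `0 < γ'`. [cite: Balaban1989LargeFieldII, Thm 1 p.355 (bookkeeping)] -/
theorem admissible_shadow₁₃SepCoPH (θ : Stage13HParams F N) (h : θ.Provisos₁₃SepCoPH F N) {γ' : ℝ} (hθ : θ.Admissible F N) (hγ' : 0 < γ') :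
    (shadow₅OfRecord₁₃SepCoPH F N θ h γ').Admissible :=
  ⟨hθ.1.1.1.1.1.1, hγ'⟩

/-- (v1.7 `H` · v1.4 SEPARATED (7)-REGULAR RANGE · Co-CLASS BACKGROUND) The shadow's upstream block IS the Stage-13 view's (`rfl`). [cite: Balaban1985UV3, Thm 1 p.257 (bookkeeping)] -/
theorem upOfRecord₅C_shadow₁₃SepCoPH (θ : Stage13HParams F N) (h : θ.Provisos₁₃SepCoPH F N) (γ' : ℝ) (P : B12.RunParams) :
    upOfRecord₅C F N (shadow₅OfRecord₁₃SepCoPH F N θ h γ') P = upOfRecord₅C F N (θ.toStage5₁₃CoPH F N) P := rfl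

/-- (v1.7 `H` · v1.4 SEPARATED (7)-REGULAR RANGE · Co-CLASS BACKGROUND) The shadow datum has the SAME CONSTRUCTION as the Stage-13 datum. [cite: Balaban1989LargeFieldII, Thm 1 + (0.1) pp.355–356 (bookkeeping)] -/
theorem datumOfRecord₅_shadow₁₃SepCoPH_C (θ : Stage13HParams F N) (h : θ.Provisos₁₃SepCoPH F N) (γ' : ℝ) :
    (datumOfRecord₅ F N (shadow₅OfRecord₁₃SepCoPH F N θ h γ')).C = (datumOfRecord₁₃SepCoPH F N θ h).C :=
  datumOfRecord_C_eq_datumOfTower F N (machineOfRecord₅ F N (shadow₅OfRecord₁₃SepCoPH F N θ h γ')) (towerOfRecord₁₃SepCoPH F N θ h) (fun _ _ => rfl)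

/-- (v1.7 `H` · v1.4 SEPARATED (7)-REGULAR RANGE · Co-CLASS BACKGROUND) … the same densities. [cite: Balaban1988Convergent, (0.2) p.244 (bookkeeping)] -/
theorem dens_datumOfRecord₅_shadow₁₃SepCoPH (θ : Stage13HParams F N) (h : θ.Provisos₁₃SepCoPH F N) (γ' : ℝ) (K : ℕ) (g₀ : ℝ) (k : ℕ) :
    (datumOfRecord₅ F N (shadow₅OfRecord₁₃SepCoPH F N θ h γ')).dens K g₀ k = (datumOfRecord₁₃SepCoPH F N θ h).dens K g₀ k :=
  dens_datumOfRecord_eq_datumOfTower F N (machineOfRecord₅ F N (shadow₅OfRecord₁₃SepCoPH F N θ h γ')) (towerOfRecord₁₃SepCoPH F N θ h) (fun _ _ => rfl) K g₀ k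

/-- (v1.7 `H` · v1.4 SEPARATED (7)-REGULAR RANGE · Co-CLASS BACKGROUND) … the same β-functions (`rfl`). [cite: Balaban1987RG1, (1.22) p.264 (bookkeeping)] -/
theorem βfun_datumOfRecord₅_shadow₁₃SepCoPH (θ : Stage13HParams F N) (h : θ.Provisos₁₃SepCoPH F N) (γ' : ℝ) :
    (datumOfRecord₅ F N (shadow₅OfRecord₁₃SepCoPH F N θ h γ')).βfun = (datumOfRecord₁₃SepCoPH F N θ h).βfun := rfl

/-- (v1.7 `H` · v1.4 SEPARATED (7)-REGULAR RANGE · Co-CLASS BACKGROUND) … and the same averaging maps (`rfl`). [cite: Balaban1987RG1, (0.4) p.253 (bookkeeping)] -/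
theorem av_datumOfRecord₅_shadow₁₃SepCoPH (θ : Stage13HParams F N) (h : θ.Provisos₁₃SepCoPH F N) (γ' : ℝ) :
    (datumOfRecord₅ F N (shadow₅OfRecord₁₃SepCoPH F N θ h γ')).av = (datumOfRecord₁₃SepCoPH F N θ h).av := rfl

/-- (v1.7 `H` · v1.4 SEPARATED (7)-REGULAR RANGE · Co-CLASS BACKGROUND) **A STAGE-13 WORLD IS A STAGE-5 RECORD AT THE SHADOW DATUM**. [cite: Balaban1989LargeFieldII, Thm 1 + (0.1) pp.355–356 (bookkeeping)] -/
theorem isRecordOfRecord₅C_shadow₁₃SepCoPH (θ : Stage13HParams F N) (h : θ.Provisos₁₃SepCoPH F N) (hθ : θ.Admissible F N) (w : WorldP)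
    (hC : w.C = (datumOfRecord₁₃SepCoPH F N θ h).C) (hγ : 0 < w.γ) (hL : w.L = (θ.L : ℝ))
    (hup : ∀ P, w.up P = upOfRecord₅C F N (θ.toStage5₁₃CoPH F N) P) :
    IsRecordOfRecord₅C F N (datumOfRecord₅ F N (shadow₅OfRecord₁₃SepCoPH F N θ h w.γ)) w :=
  isRecordOfRecord₅C_shadow F N (shadow₅OfRecord₁₃SepCoPH F N θ h w.γ) (admissible_shadow₁₃SepCoPH F N θ h hθ hγ) (towerOfRecord₁₃SepCoPH F N θ h)
    (fun _ _ => rfl) w hC rfl hL hup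

variable {F N}

/-- (v1.7 `H` · v1.4 SEPARATED (7)-REGULAR RANGE · Co-CLASS BACKGROUND) **REFINEMENT `IsRecordOfRecord₁₃CSepCoPH → IsRecordOfRecord₅C` AT THE SHADOW**: every Stage-13 record's world is a Stage-5 record at a datum with THE SAME construction,
densities, β-functions and averaging maps. [cite: Balaban1989LargeFieldII, Thm 1 + (0.1) pp.355–356 (bookkeeping)] -/
theorem exists_isRecordOfRecord₅C_of_isRecordOfRecord₁₃CSepCoPH {D : FiniteEpsData F (SU N)} {w : WorldP} (h : IsRecordOfRecord₁₃CSepCoPH F N D w) :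
    ∃ D₅ : FiniteEpsData F (SU N), IsRecordOfRecord₅C F N D₅ w ∧ D₅.C = D.C ∧ (∀ K g₀ k, D₅.dens K g₀ k = D.dens K g₀ k) ∧
      D₅.βfun = D.βfun ∧ D₅.av = D.av := by
  obtain ⟨θ, hP, hθ, rfl, hC, ⟨hγ0, -⟩, hL, hup⟩ := h
  exact ⟨_, isRecordOfRecord₅C_shadow₁₃SepCoPH F N θ hP hθ w hC hγ0 hL hup, datumOfRecord₅_shadow₁₃SepCoPH_C F N θ hP w.γ,
    dens_datumOfRecord₅_shadow₁₃SepCoPH F N θ hP w.γ, rfl, rfl⟩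

/-- (v1.7 `H` · v1.4 SEPARATED (7)-REGULAR RANGE · Co-CLASS BACKGROUND) **TRANSFER**: every node statement established over the Stage-5 record predicate in the `AtRecord` shape holds at every run of every Stage-13 record's world.
[cite: Balaban1989LargeFieldII, Thm 1 p.355 (bookkeeping)] -/
theorem atWorld_of_isRecordOfRecord₁₃CSepCoPH {X : Dag.Leaves → Prop}
    (h₅ : ∀ (D : FiniteEpsData F (SU N)) (w : WorldP), IsRecordOfRecord₅C F N D w → ∀ P : B12.RunParams, X (leavesP w P))
    {D : FiniteEpsData F (SU N)} {w : WorldP} (h : IsRecordOfRecord₁₃CSepCoPH F N D w) (P : B12.RunParams) : X (leavesP w P) := by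
  obtain ⟨D₅, h5, -⟩ := exists_isRecordOfRecord₅C_of_isRecordOfRecord₁₃CSepCoPH h
  exact h₅ D₅ w h5 P

section TransferredSepCoPH

variable {D : FiniteEpsData F (SU N)} {w : WorldP}

/-- (v1.7 `H` · v1.4 SEPARATED (7)-REGULAR RANGE · Co-CLASS BACKGROUND) Instance · GUARDED (0.20) at every Stage-13 record. [cite: Balaban1987RG1, (0.20) p.256] -/
theorem rgFlow_of_smallCouplings_of_isRecordOfRecord₁₃CSepCoPH (h : IsRecordOfRecord₁₃CSepCoPH F N D w) (P : B12.RunParams)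
    (hsc : (leavesP w P).smallCouplings) : (leavesP w P).rgFlow := by
  obtain ⟨D₅, h5, -⟩ := exists_isRecordOfRecord₅C_of_isRecordOfRecord₁₃CSepCoPH h
  exact rgFlow_of_smallCouplings_of_isRecordOfRecord₅C h5 P hsc

/-- (v1.7 `H` · v1.4 SEPARATED (7)-REGULAR RANGE · Co-CLASS BACKGROUND) Instance · N01 `Dag.B4_main` at every run of every Stage-13 record. [cite: Balaban1983RegularityDecay, Theorem p.573 (kernel version, transferred)] -/
theorem b4_main_of_isRecordOfRecord₁₃CSepCoPH (h : IsRecordOfRecord₁₃CSepCoPH F N D w) (P : B12.RunParams) : Dag.B4_main (leavesP w P) :=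
  atWorld_of_isRecordOfRecord₁₃CSepCoPH (fun _ _ h5 P => b4_main_of_isRecordOfRecord₅C h5 P) h P

/-- (v1.7 `H` · v1.4 SEPARATED (7)-REGULAR RANGE · Co-CLASS BACKGROUND) Instance · N02 `Dag.B5_main` at every run of every Stage-13 record. [cite: Balaban1984PropagatorsI, Props. 1.1–1.2 pp.33–36 (kernel versions, transferred)] -/
theorem b5_main_of_isRecordOfRecord₁₃CSepCoPH (h : IsRecordOfRecord₁₃CSepCoPH F N D w) (P : B12.RunParams) : Dag.B5_main (leavesP w P) :=
  atWorld_of_isRecordOfRecord₁₃CSepCoPH (fun _ _ h5 P => b5_main_of_isRecordOfRecord₅C h5 P) h P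

/-- (v1.7 `H` · v1.4 SEPARATED (7)-REGULAR RANGE · Co-CLASS BACKGROUND) Instance · N04 `Dag.B7_main` at every run of every Stage-13 record. [cite: Balaban1985Averaging, Props. 1–10 pp.26–50 (kernel version, transferred)] -/
theorem b7_main_of_isRecordOfRecord₁₃CSepCoPH (h : IsRecordOfRecord₁₃CSepCoPH F N D w) (P : B12.RunParams) : Dag.B7_main (leavesP w P) :=
  atWorld_of_isRecordOfRecord₁₃CSepCoPH (fun _ _ h5 P => b7_main_of_isRecordOfRecord₅C h5 P) h P

/-- (v1.7 `H` · v1.4 SEPARATED (7)-REGULAR RANGE · Co-CLASS BACKGROUND) Instance · the END headline at a Stage-13 record needs NO `rgFlow` binder. [cite: Balaban1989LargeFieldII, Thm 1 p.355 + p.391] -/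
theorem endStatementBPrinted_of_isRecordOfRecord₁₃CSepCoPH_of_nodes (h : IsRecordOfRecord₁₃CSepCoPH F N D w) {γ₀ : ℝ} (hγ₀ : w.γ ≤ γ₀)
    (hnodes : ∀ P, Nodes (leavesP w P)) (hβ : BetaBoundsInInterval w.C.toB12 γ₀ w.b w.βup) :
    B16.EndStatementBPrinted D.C := by
  obtain ⟨D₅, h5, hC5, -⟩ := exists_isRecordOfRecord₅C_of_isRecordOfRecord₁₃CSepCoPH h
  rw [← hC5]
  exact endStatementBPrinted_of_isRecordOfRecord₅C_of_nodes h5 hγ₀ hnodes hβ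

end TransferredSepCoPH

section BetaLayerSepCoPH

variable {D : FiniteEpsData F (SU N)} {w : WorldP}

variable (F N) in
/-- (v1.7 `H` · v1.4 SEPARATED (7)-REGULAR RANGE · Co-CLASS BACKGROUND) FACE `A_{k+1}`: the core's effective action at step `k+1` IS (0.19)'s `log(𝐍_k⁻¹ · (T_k(χ_k e^{−GF∕g_k²+A_k}))(V))` with `T_k := TcanOfRecord`,
`χ_k := chiFixed29 θ.ν θ.ε₂₉` along the ₁₃ history (`rfl`) — the VALUES this record's β reads: values of a VERSION, canonical by construction, equal to
print's point values wherever the transform's a.e.-class has a continuous representative near the point (`betaInput_eqOn_of_continuousOn₁₃`) and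
nowhere asserted to be print's elsewhere. [cite: Balaban1987RG1, (0.19) p.255, p.259 (bookkeeping)] -/
theorem effAction_succ_stage13SepCoPH (θ : Stage13HParams F N) (h : θ.Provisos₁₃SepCoPH F N) (p : B12.RunParams) (k : ℕ) (V : GaugeField (F.P p.K) (k + 1) (SU N)) :
    ((datumOfRecord₁₃SepCoPH F N θ h).C p).effAction (k + 1) V =
      Real.log ((normConstHT F N (TcanOfRecord F N) (chiFixed29 F N θ.ν θ.ε₂₉) p.K (gOfRecord₁₃ F N θ.toStage13Params p) k)⁻¹ *
        TcanOfRecord F N p.K k (integrand (chiFixed29 F N θ.ν θ.ε₂₉ p.K (gOfRecord₁₃ F N θ.toStage13Params p) k) (gfOfRecord F N p.K k)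
          (gOfRecord₁₃ F N θ.toStage13Params p k)
          (effActionHT F N (TcanOfRecord F N) (chiFixed29 F N θ.ν θ.ε₂₉) p.K (gOfRecord₁₃ F N θ.toStage13Params p) k)) V) := rfl

/-- (v1.7 `H` · v1.4 SEPARATED (7)-REGULAR RANGE · Co-CLASS BACKGROUND) **A Stage-13 record's β IS the χ-generic β at the canonical-version transport and the (2.9) species at a positive threshold `ε₂₉`** (elimination face for
β-readers: NODE O, N24, N26). [cite: Balaban1987RG1, (1.20)–(1.22) p.264, (2.9) p.266, (0.13) p.254 (bookkeeping)] -/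
theorem exists_beta_of_isRecordOfRecord₁₃CSepCoPH (h : IsRecordOfRecord₁₃CSepCoPH F N D w) :
    ∃ (θ : Stage13HParams F N) (hP : θ.Provisos₁₃SepCoPH F N), θ.Admissible F N ∧ D = datumOfRecord₁₃SepCoPH F N θ hP ∧
      D.βfun = betaOfRecord₈Tχ F N (TcanOfRecord F N) (chiFixed29 F N θ.ν θ.ε₂₉) θ.toStage8Params ∧ 0 < θ.ε₂₉ := by
  obtain ⟨θ, hP, hθ, hD, -⟩ := h
  exact ⟨θ, hP, hθ, hD, hD ▸ rfl, hθ.2⟩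

end BetaLayerSepCoPH

end CoRangeH

/-! ## §H2. THE HISTORY-BLIND EMBEDDING OF THE v1.6 `SepCoPR` RECORD (director-ym LINE №183 H1ʰ (d)): v1.6's displayed provisos `Provisos₁₃SepCoPR` GIVE
`Provisos₁₃SepCoPH` at `Stage13HParams.ofHistoryBlind θ` (rows verbatim, `zhLaws p n Ω Λ := zrLaws p`, `zhLocal p n Ω Λ := zrLocal p`; row `bg` unchanged); the
datum of record and the record family of THIS file at the embedding ARE the v1.6 ones (`rfl` ∕ one-way inclusion) — whence the K-text bridge «⁷-inhabited ⇐ ⁶-inhabited»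
is the consumer's one-liner (not stated here); composed with FILE 26T §R2, every v1.5 `SepCoP` record is a v1.7 `SepCoPH` record. -/

section HistoryBlindSepCoPH

variable {F N} in
/-- **v1.6's displayed provisos GIVE the v1.7 provisos at the history-blind embedding** (rows verbatim incl. `hM`, `hM₁`, `bg`; `zhLaws p n Ω Λ := zrLaws p`,
`zhLocal p n Ω Λ := zrLocal p`). [cite: Balaban1988Convergent, (2.21) p.258, (3.16) p.268, p.259 (bookkeeping)] -/
theorem Stage13RParams.Provisos₁₃SepCoPR.ofHistoryBlind {θ : Stage13RParams F N} (h : θ.Provisos₁₃SepCoPR F N) :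
    (Stage13HParams.ofHistoryBlind F N θ).Provisos₁₃SepCoPH F N where
  intPiece := h.intPiece
  measω := h.measω
  measChi := h.measChi
  zetaUnity := h.zetaUnity
  zetaAbs := h.zetaAbs
  rstep := fun p k _ hk => h.rstep p k hk
  rzLaws := h.rzLaws
  zhLaws := fun p _ _ _ => h.zrLaws p
  zhLocal := fun p _ _ _ => h.zrLocal p
  hM := h.hM
  hM₁ := h.hM₁
  bg := h.bg

variable {F N} in
/-- The two projections to the core commute with the embedding (proof-irrelevant bookkeeping, `rfl`). [cite: Balaban1988Convergent, (2.21) p.258 (bookkeeping)] -/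
theorem Stage13RParams.Provisos₁₃SepCoPR.ofHistoryBlind_toCore {θ : Stage13RParams F N} (h : θ.Provisos₁₃SepCoPR F N) :
    h.ofHistoryBlind.toCore = h.toCore.ofHistoryBlind := rfl

variable {F N} in
/-- **AT DATUM LEVEL, SEPARATED RANGE**: the v1.7 datum of record at the history-blind embedding IS the v1.6 datum of record (`rfl`) — the datum and its faces read
neither `Zh` nor `Phih`. [cite: Balaban1987RG1, (0.4) p.253 (bookkeeping)] -/
theorem datumOfRecord₁₃SepCoPH_ofHistoryBlind {θ : Stage13RParams F N} (h : θ.Provisos₁₃SepCoPR F N) :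
    datumOfRecord₁₃SepCoPH F N (Stage13HParams.ofHistoryBlind F N θ) h.ofHistoryBlind = datumOfRecord₁₃SepCoPR F N θ h := rfl

variable {F N} in
/-- **EVERY v1.6 RECORD IS A v1.7 RECORD** (same datum, same world; along `Stage13HParams.ofHistoryBlind`).  One-way: a v1.7 record's residual 𝐓-weights need not be
history-blind. [cite: Balaban1989LargeFieldII, Thm 1 + (0.1) pp.355–356 (bookkeeping)] -/
theorem IsRecordOfRecord₁₃CSepCoPH.ofCoPR {D : FiniteEpsData F (SU N)} {w : WorldP} (h : IsRecordOfRecord₁₃CSepCoPR F N D w) :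
    IsRecordOfRecord₁₃CSepCoPH F N D w := by
  obtain ⟨θ, hP, hθ, hD, hC, hγ, hL, hup⟩ := h
  exact ⟨Stage13HParams.ofHistoryBlind F N θ, hP.ofHistoryBlind, hθ, hD.trans (datumOfRecord₁₃SepCoPH_ofHistoryBlind hP).symm, hC, hγ, hL,
    fun P => (hup P).trans (congrArg (fun ϑ => upOfRecord₅C F N ϑ P) (Stage13HParams.toStage5₁₃CoPH_ofHistoryBlind F N θ).symm)⟩

variable {F N} in
/-- … hence (with FILE 26T §R2) **EVERY v1.5 `SepCoP` RECORD IS A v1.7 `SepCoPH` RECORD**. [cite: Balaban1989LargeFieldII, Thm 1 + (0.1) pp.355–356 (bookkeeping)] -/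
theorem IsRecordOfRecord₁₃CSepCoPH.ofCoP {D : FiniteEpsData F (SU N)} {w : WorldP} (h : IsRecordOfRecord₁₃CSepCoP F N D w) :
    IsRecordOfRecord₁₃CSepCoPH F N D w := IsRecordOfRecord₁₃CSepCoPH.ofCoPR (IsRecordOfRecord₁₃CSepCoPR.ofCoP h)

end HistoryBlindSepCoPH

end Literature.MathematicalPhysics.QuantumFieldTheory.Balaban1983to89.Node00

end
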